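import Summits.QuantumFields.YangMills.Theorems.IR.MomentumPincerNoLightMoversSC
import Summits.QuantumFields.YangMills.Theorems.IR.SCFloorFacingPlaquette
import Summits.QuantumFields.YangMills.Theorems.IR.SCFloorSliceSums
import Literature.MathematicalPhysics.QuantumFieldTheory.OneLinkTraceShift
import Summits.QuantumFields.YangMills.Theorems.SoloBlindLatticeGapEndpoints
import Summits.QuantumFields.YangMills.Theorems.SoloBlindSmearedSpecies
import Summits.QuantumFields.YangMills.Theorems.SoloBlindSpacingPinning
import Summits.QuantumFields.YangMills.Theorems.SoloBlindOddTorusCorrelator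
import HarnessLib

/-!
# Line `momentum-pincer` (crux `IR`, stmt-QuantumFields-19354): rung R2 — the RP / transfer-matrix HALF of
# `NoLightMoversSCTransfer` — PROVED, sorry-free: `noLightMoversSCTransfer_holds` (v6: RP/TM + F0 + (F) + far field (§1–§4, this line) + the `SCFloor` engine's LANDED slice floor `sliceSum_one_floor` (§5, ym-ir-line-bsf-p1 part 19))

Route `BalabanLadder`, crux `IR`, line `momentum-pincer` (ideator ym-ir-idea-5, lens: RP transfer-matrix bounds;
skeleton `Cruxes/IR/Lines/momentum_pincer.lean` v1.6, stub `stub_noLightMoversSCTransfer : NoLightMoversSCTransfer`,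
rung R2 of `Cruxes/IR/Lines/momentum-pincer-rungs.md`).  This file isolates the ONE strong-coupling input of R2 as the
typed statement `SliceFloorSC` (a volume-uniform two-point FLOOR for the zero-momentum plaquette correlator at time
distances `0` and `1` on a compact strong-coupling window — the output of the SC floor engine `Theorems/IR/SCFloor*.lean`
of ym-ir-line-bsf-p1, whose facing-plaquette floor `SCFloor.facingPlaquetteCorr_floor` is the `x⃗ = 0` term of `s(1)`)
and PROVES everything else:

* §1 `latticeConnectedCorr_sliceSpecies` — the SLICE IDENTITY `(2S+1)³ · s_S(t) = c_{Ψ_S,Ψ_S}(t)`: the zero-momentum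
  (slice-summed) correlator `s_S(t) = sliceSumCorr ρ β S P P t` is, up to the number of spatial sites, the
  self-correlator of the SLICE SPECIES `Ψ_S = Σ_{x⃗} P(· + (0,x⃗))` (tree: bilinearity `latticeConnectedCorr_linCombSpecies`,
  translation invariance `latticeConnectedCorr_comp_configShift`, `(2S+1)ℤ⁴`-periodicity of transported observables
  `toTorusObservable_comp_configShift`, and re-indexing of the spatial torus);
* §2 hence, for a time-zero spatial `P`, `t ↦ s_S(t)` is NON-NEGATIVE and LOG-CONVEX on the odd torus (reflection
  positivity / transfer matrix: tree `latticeConnectedCorr_self_nonneg`, `latticeConnectedCorr_self_logConvex` applied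
  to `Ψ_S`), so a two-point floor `s_S(0) ≤ s_max`, `f₁ ≤ s_S(1)` propagates to the GEOMETRIC FLOOR
  `s_S(n) ≥ (f₁/s_max)^{n-1} f₁`, `1 ≤ n ≤ 2S+1` (tree `mulConvex_ratio_floor`, `mulConvex_lower_envelope`);
* §3 `noLightMoversSCTransfer_of_sliceFloorSC` — the RATE CEILING and the assembly: any valid zero-momentum clustering
  rate `m(β)` on the window obeys `m(β) ≤ L := -log (f₁/s_max)` (floor at `t = S` against the hypothesis at `t = S`,
  tree `rate_le_of_eventually_exp_le`), so with `θ := c / max(L, c)` the β-uniform strong-coupling point clustering at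
  rate `c` (R1, `noLightMoversSC_holds`) is clustering at rate `θ·m(β) ≤ c`.  The conclusion is VERBATIM the body of
  `Summit.QuantumFields.YangMills.Cruxes.IR.MomentumPincer.NoLightMoversSCTransfer` (copies of `spatialVec`,
  `sliceSumCorr` below are verbatim), so the skeleton's stub closes by
  `theorem stub_noLightMoversSCTransfer : NoLightMoversSCTransfer := noLightMoversSCTransfer_of_sliceFloorSC h`
  (definitional unfolding only) as soon as `h : SliceFloorSC` is proved by the SC engine.
* §2b `sliceSumCorr_zero_le` (F0) — the datum `s_S(0) ≤ s_max` is FREE: it holds for every species, uniformly in `S`,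
  on a window `0 ≤ β ≤ β₀`, by the β-uniform strong-coupling clustering `torusClustering_uniform_fixedRate` (R1's
  engine) and `Σ_{x⃗ ∈ 𝕋³_{2S+1}} e^{-‖x⃗‖_∞} ≤ (Σ_{k ∈ ℤ} e^{-|k|/3})³`;
* §3b hence the SMALLER inputs `SliceOneFloorSC` (only `f₁ ≤ s_S(1)`) and `SlicePowerFloorSC` (`c β^k ≤ s_S(1)` for
  `0 < β ≤ β₀`, `S ≥ S₀` — the shape the `SCFloor` engine produces, `k = 4` for a plaquette) each imply
  `NoLightMoversSCTransfer` (`noLightMoversSCTransfer_of_sliceOneFloorSC`, `noLightMoversSCTransfer_of_slicePowerFloorSC`).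
  What remains for the engine on top of its LANDED facing floor `c β⁴ ≤ Cov(P_{e₀}, P)` is the single estimate
  `|Σ_{x⃗ ≠ 0} Cov(P_{(1,x⃗)}, P)| ≤ (c/2) β⁴` for `S ≥ S₀`, `β ≤ β₀` (order-4 peeling + far-field clustering).
* §3c the CONCRETE targets over the spatial plaquette `P = Re tr ρ(U_{(0;1,2)})` (`plaquetteObs ρ 0 1 2`, the engine's
  object): `PlaquetteFacingFloorSC` (F) = the landed facing floor on odd tori (modulo its non-constant-character
  hypothesis), `PlaquetteOffDiagSliceSC` (O) = `|s_S(1) − Cov(P, P_{e₀})| ≤ C β⁵` uniformly in `S ≥ S₀` — THE remaining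
  estimate —, `sliceSumCorr_split` (`s_S = diagonal + Σ_{x⃗ ≠ 0}`), and the assembly
  `noLightMoversSCTransfer_of_facing_offdiag : PlaquetteFacingFloorSC → PlaquetteOffDiagSliceSC → NoLightMoversSCTransfer`.
* §3d (F) is PROVED (`plaquetteFacingFloorSC_holds`): the engine's LANDED `SCFloor.facingPlaquetteCorr_floor` (p606286) with
  its non-constant-character hypothesis discharged (`LatticeRep.exists_re_trace_ne`: `N − Re tr X = ½‖X − 1‖²_F` and
  faithfulness).  NET RESULT: `noLightMoversSCTransfer_of_offdiag : PlaquetteOffDiagSliceSC → NoLightMoversSCTransfer` —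
  R2 ⇐ the single volume-uniform estimate `|Σ_{x⃗ ≠ 0} Cov(P_{(0,x⃗)}, P_{e₀})| ≤ C β⁵`.
* §4 (O) SPLIT, far field PROVED: `torusClustering_uniform_activity` re-runs R1's Osterwalder–Seiler polymer bound
  KEEPING THE ACTIVITY, `|Cov(F₁, F₂∘θ_x)| ≤ K (β/r)^{‖x‖_∞ − c}` uniformly in the volume and in `0 ≤ β ≤ r`
  (R1 traded `(β/r)^n` for `e^{-n}`); `latticeConnectedCorr_shift_left` puts the slice term at `(t, x⃗)` in engine form
  with the single displacement `farVec = -t e₀ − (0,x⃗)`; `sliceSum_far_le`: `Σ_{‖x⃗‖_∞ ≥ c+k+1} |Cov(A_{(0,x⃗)}, B; t)| ≤ C β^k`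
  for ALL `S ≥ t` (geometric tail × `(Σ_{k∈ℤ} e^{-|k|/3})³`).  Hence (O) ⇐ `PlaquetteNearPairSC` (N): for each FIXED
  spatial `a ≠ 0`, `|Cov_L(P∘θ_{(0,a)}, P; 1)| ≤ C_a β⁵` for `0 < β ≤ β₀(a)`, all `L ≥ L₀(a)` — finitely many `a`
  (`‖a‖_∞ ≤ c + 5`) are used (`plaquetteOffDiagSliceSC_of_nearPair`, re-indexing `x⃗ ↦ valMinAbs ∘ x⃗` injective).
  NET RESULT (v5): `noLightMoversSCTransfer_of_nearPair : PlaquetteNearPairSC → NoLightMoversSCTransfer`.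
* §5 **R2 CLOSED** (v6): the engine's part 19 `SCFloor.sliceSum_one_floor` (LANDED, `Theorems/IR/SCFloorSliceSums.lean`:
  `κ β⁴ ≤ s_S(1)`, `0 < β ≤ β₀`, all `S ≥ 1`, under `∃ g h, Re tr ρ g ≠ Re tr ρ h`) is literally `PlaquetteSlicePowerFloorSC`
  once the character hypothesis is discharged by §3d; hence `plaquetteSlicePowerFloorSC_holds` and
  `noLightMoversSCTransfer_holds : NoLightMoversSCTransfer` — the registered stub closes BY NAME
  (`theorem stub_noLightMoversSCTransfer : NoLightMoversSCTransfer := MomentumPincerRung.noLightMoversSCTransfer_holds`,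
  kernel-tested against the verbatim skeleton decls, rc 0).  §4's (N)-route stays as the engine-light alternative.

HONEST FRAMING: strong coupling only, group-blind (simplicity of `G` is carried, not used); R2 is a RUNG exercising the
line's `p⃗ = 0 ⇒ point` transfer where the dispersion relation is computable; nothing here bears on `IR` at weak
coupling, on a continuum limit, or on the Yang–Mills mass gap (Clay); R4 of the ladder closes only the conditional
finite-𝕋⁴ rung `BalabanLadder.UV`.
Refs: K. Osterwalder, E. Seiler, Ann. Phys. 110 (1978) 440 (§2 RP / transfer matrix, Thm. 3.5 clustering);
E. Seiler, LNP 159 (1982) Ch. 2; J. Glimm, A. Jaffe, *Quantum Physics* (1987) §6.1; line card `Cruxes/IR/Lines/momentum-pincer.md`.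
-/

set_option autoImplicit false

noncomputable section

open Filter Topology MeasureTheory Finset
open Literature.MathematicalPhysics.QuantumFieldTheory Literature.MathematicalPhysics.QuantumLattice
open Literature.Probability.LatticeModels (Torus.proj Torus.proj_apply)
open Literature.Probability.LatticeModels.Site (supNorm supNorm_le_iff natAbs_le_supNorm norm_eq_supNorm)
open Summit.QuantumFields.YangMills.Theorems.SoloBlind

namespace Summit.QuantumFields.YangMills.Cruxes.IR.MomentumPincerRung

variable {G : Type} [Group G] [TopologicalSpace G] [IsTopologicalGroup G] [CompactSpace G]
  [MeasurableSpace G] [BorelSpace G]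

/-! ## §0 The line's objects (verbatim copies of `Cruxes/IR/Lines/momentum_pincer.lean` §1, which is not importable) -/

/-- The purely spatial `ℤ⁴`-vector `(0, x⃗)` below a spatial torus site `x⃗ ∈ (ℤ/(2S+1))³` (centred representatives).
VERBATIM `Summit.QuantumFields.YangMills.Cruxes.IR.MomentumPincer.spatialVec`. -/
def spatialVec (S : ℕ) (x : Fin 3 → ZMod (2 * S + 1)) : Fin 4 → ℤ :=
  fun i => if h : i = 0 then 0 else (x (i.pred h)).valMinAbs

/-- **Zero-momentum connected time-correlation** on the torus `(2S+1)⁴` (slice sum over spatial translates of `A`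
against `B` at time `t`).  VERBATIM `Summit.QuantumFields.YangMills.Cruxes.IR.MomentumPincer.sliceSumCorr`. -/
def sliceSumCorr {N : ℕ} (ρ : G →* Matrix (Fin N) (Fin N) ℂ) (β : ℝ) (S : ℕ) (A B : LGConfig 4 G → ℝ) (t : ℕ) : ℝ :=
  ∑ x : Fin 3 → ZMod (2 * S + 1),
    latticeConnectedCorr ρ β (2 * S + 1) (fun U => A (configShift (spatialVec S x) U)) B t

/-- **R2 — `NoLightMoversSCTransfer`** (VERBATIM the body of
`Summit.QuantumFields.YangMills.Cruxes.IR.MomentumPincer.NoLightMoversSCTransfer`): on a compact strong-coupling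
window `[β₁, β₀]`, zero-momentum clustering at ANY valid rate `m(β)` transfers to point clustering at rate `θ·m(β)`. -/
def NoLightMoversSCTransfer : Prop :=
  ∀ (G : Type) [Group G] [TopologicalSpace G] [IsTopologicalGroup G] [CompactSpace G],
    IsCompactSimpleLieGroup G → letI : MeasurableSpace G := borel G; haveI : BorelSpace G := ⟨rfl⟩;
    ∀ r : LatticeRep G, ∃ β₁ β₀ θ : ℝ, 0 < β₁ ∧ β₁ < β₀ ∧ 0 < θ ∧
      ∀ (m : ℝ → ℝ) (S₁ : ℝ → ℕ), (∀ β, 0 < m β) →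
        (∀ A B : YMSpecies G, ∃ C : ℝ, ∀ β : ℝ, β₁ ≤ β → β ≤ β₀ → ∀ S t : ℕ, S₁ β ≤ S → t ≤ S →
            |sliceSumCorr r.ρ β S A.F B.F t| ≤ C * Real.exp (-(m β * t))) →
        ∃ S₃ : ℝ → ℕ, ∀ A B : YMSpecies G, ∃ C : ℝ, ∀ β : ℝ, β₁ ≤ β → β ≤ β₀ → ∀ S t : ℕ, S₃ β ≤ S → t ≤ S →
            |latticeConnectedCorr r.ρ β (2 * S + 1) A.F B.F t| ≤ C * Real.exp (-(θ * m β * t))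

/-- **THE STRONG-COUPLING INPUT of R2 (`SliceFloorSC`)** — a volume-uniform TWO-POINT FLOOR for the zero-momentum
self-correlator of ONE time-zero spatial species `P` (intended: the spatial plaquette `plaquetteObservable r.ρ _ 1 2`):
for every compact window `[β₁, β₀]` inside the strong-coupling island, on all large odd tori,
`s_S(0) ≤ s_max` (the zero-momentum susceptibility is bounded: summable clustering) and `s_S(1) ≥ f₁ > 0`
(the facing-plaquette floor `c β⁴ ≤ c_{P,P}(1)` of `SCFloor.facingPlaquetteCorr_floor` plus `O(β⁵)` control of the
off-diagonal slice terms).  No variance floor is needed (monotonicity gives `s_S(0) ≥ s_S(1)`).  The natural engine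
output `∃ β₀ s_max κ > 0, ∀ β ∈ (0, β₀], ∀ S ≥ 1, s_S(0) ≤ s_max ∧ κ β⁴ ≤ s_S(1)` implies it with `f₁ := κ β₁⁴`. -/
def SliceFloorSC : Prop :=
  ∀ (G : Type) [Group G] [TopologicalSpace G] [IsTopologicalGroup G] [CompactSpace G],
    IsCompactSimpleLieGroup G → letI : MeasurableSpace G := borel G; haveI : BorelSpace G := ⟨rfl⟩;
    ∀ r : LatticeRep G, ∃ β₀ : ℝ, 0 < β₀ ∧ ∃ P : YMSpecies G, (∀ e ∈ P.supp, e.1 0 = 0 ∧ e.2 ≠ 0) ∧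
      ∀ β₁ : ℝ, 0 < β₁ → β₁ < β₀ → ∃ sMax f₁ : ℝ, ∃ S₀ : ℕ, 0 < f₁ ∧
        ∀ β : ℝ, β₁ ≤ β → β ≤ β₀ → ∀ S : ℕ, S₀ ≤ S →
          sliceSumCorr r.ρ β S P.F P.F 0 ≤ sMax ∧ f₁ ≤ sliceSumCorr r.ρ β S P.F P.F 1

/-! ## §1 The slice identity `(2S+1)³ · s_S(t) = c_{Ψ_S,Ψ_S}(t)` -/

omit [Group G] [TopologicalSpace G] [IsTopologicalGroup G] [CompactSpace G] [BorelSpace G] in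
/-- Translations compose: `θ_a (θ_b U) = θ_{a+b} U`. [folklore] -/
theorem configShift_configShift (a b : Fin 4 → ℤ) (U : LGConfig 4 G) :
    configShift a (configShift b U) = configShift (a + b) U := by
  funext e
  simp only [configShift_apply, sub_sub]

/-- The statement's correlator sees its first argument only through the transported (torus) observable. [folklore] -/
theorem latticeConnectedCorr_congr_left {N : ℕ} (ρ : G →* Matrix (Fin N) (Fin N) ℂ) (β : ℝ) (L : ℕ) [NeZero L]
    {A A' : LGConfig 4 G → ℝ} (B : LGConfig 4 G → ℝ) (h : toTorusObservable L A = toTorusObservable L A') (n : ℕ) :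
    latticeConnectedCorr ρ β L A B n = latticeConnectedCorr ρ β L A' B n := by
  have h' : ∀ U, A (torusLift L U) = A' (torusLift L U) := fun U => congrFun h U
  simp only [latticeConnectedCorr, h']

omit [Group G] [TopologicalSpace G] [IsTopologicalGroup G] [CompactSpace G] [BorelSpace G] in
/-- `Lℤ⁴`-PERIODICITY of transported translates: `F ∘ θ_u` and `F ∘ θ_{u'}` agree on `L`-periodic configurations when
`u ≡ u' (mod L)`. [folklore] -/
theorem toTorusObservable_comp_configShift_congr {α : Type*} (L : ℕ) (F : LGConfig 4 G → α) {u u' : Fin 4 → ℤ}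
    (h : Torus.proj L u = Torus.proj L u') :
    toTorusObservable L (F ∘ configShift u) = toTorusObservable L (F ∘ configShift u') := by
  rw [toTorusObservable_comp_configShift, toTorusObservable_comp_configShift, h]

/-- Differences of centred representatives represent differences: `(0, x⃗)̃ − (0, y⃗)̃ ≡ (0, x⃗ − y⃗)̃ (mod 2S+1)`. -/
theorem proj_spatialVec_sub (S : ℕ) (x y : Fin 3 → ZMod (2 * S + 1)) :
    Torus.proj (2 * S + 1) (spatialVec S x - spatialVec S y) = Torus.proj (2 * S + 1) (spatialVec S (x - y)) := by
  funext i
  by_cases hi : i = 0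
  · subst hi
    simp [Torus.proj, spatialVec]
  · simp [Torus.proj, spatialVec, hi, ZMod.coe_valMinAbs]

/-- `(0, x⃗)̃` is spatial. -/
@[simp] theorem spatialVec_zero (S : ℕ) (x : Fin 3 → ZMod (2 * S + 1)) : spatialVec S x 0 = 0 := by
  simp [spatialVec]

/-- `(0, 0⃗)̃ = 0`. -/
@[simp] theorem spatialVec_zero_right (S : ℕ) : spatialVec S (0 : Fin 3 → ZMod (2 * S + 1)) = 0 := by
  funext i
  by_cases hi : i = 0
  · subst hi; simp [spatialVec]
  · simp [spatialVec, dif_neg hi]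

/-- **The slice species** `Ψ_S := Σ_{x⃗ ∈ (ℤ/(2S+1))³} P(· + (0,x⃗)̃)` (unit weights): a gauge-invariant local observable,
time-zero spatial when `P` is. -/
def sliceSpecies (S : ℕ) (P : YMSpecies G) : YMSpecies G :=
  linCombSpecies (Finset.univ : Finset (Fin 3 → ZMod (2 * S + 1))) (fun _ => (1 : ℝ))
    fun x => translateSpecies P (-(spatialVec S x))

omit [TopologicalSpace G] [IsTopologicalGroup G] [CompactSpace G] [BorelSpace G] in
/-- The slice species of a time-zero spatial species is time-zero spatial. -/
theorem sliceSpecies_timeZeroSpatial (S : ℕ) {P : YMSpecies G} (hP : ∀ e ∈ P.supp, e.1 0 = 0 ∧ e.2 ≠ 0) :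
    ∀ e ∈ (sliceSpecies S P).supp, e.1 0 = 0 ∧ e.2 ≠ 0 :=
  isTimeZeroSpatial_linCombSpecies fun x _ =>
    isTimeZeroSpatial_translateSpecies (A := P) hP (z := -(spatialVec S x)) (by simp)

/-- One pair term of `c_{Ψ,Ψ}`: `c_{P∘θ_{x̃}, P∘θ_{ỹ}}(t) = c_{P∘θ_{(x−y)̃}, P}(t)` (translation invariance by `ỹ`,
then periodicity `x̃ − ỹ ≡ (x − y)̃`). -/
theorem latticeConnectedCorr_pair_eq {N : ℕ} (ρ : G →* Matrix (Fin N) (Fin N) ℂ) (β : ℝ) (S : ℕ)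
    (P : LGConfig 4 G → ℝ) (x y : Fin 3 → ZMod (2 * S + 1)) (t : ℕ) :
    latticeConnectedCorr ρ β (2 * S + 1) (P ∘ configShift (spatialVec S x)) (P ∘ configShift (spatialVec S y)) t =
      latticeConnectedCorr ρ β (2 * S + 1) (fun U => P (configShift (spatialVec S (x - y)) U)) P t := by
  have hcomp : P ∘ configShift (spatialVec S x) =
      (P ∘ configShift (spatialVec S x - spatialVec S y)) ∘ configShift (spatialVec S y) := by
    funext U
    simp only [Function.comp_apply, configShift_configShift, sub_add_cancel]
  rw [hcomp, latticeConnectedCorr_comp_configShift]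
  exact latticeConnectedCorr_congr_left ρ β (2 * S + 1) P
    (toTorusObservable_comp_configShift_congr (2 * S + 1) P (proj_spatialVec_sub S x y)) t

/-- **SLICE IDENTITY.**  `c_{Ψ_S,Ψ_S}(t) = (2S+1)³ · s_S(t)`: the self-correlator of the slice species is the number of
spatial sites times the zero-momentum correlator `sliceSumCorr ρ β S P P t`. [this line's; folklore mechanism] -/
theorem latticeConnectedCorr_sliceSpecies {N : ℕ} (ρ : G →* Matrix (Fin N) (Fin N) ℂ) (hρ : Continuous ρ) (β : ℝ)
    (S : ℕ) (P : YMSpecies G) (t : ℕ) :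
    latticeConnectedCorr ρ β (2 * S + 1) (sliceSpecies S P).F (sliceSpecies S P).F t =
      (Fintype.card (Fin 3 → ZMod (2 * S + 1)) : ℝ) * sliceSumCorr ρ β S P.F P.F t := by
  classical
  unfold sliceSpecies
  rw [latticeConnectedCorr_linCombSpecies ρ hρ]
  simp only [translateSpecies_F, neg_neg, one_mul, latticeConnectedCorr_pair_eq]
  have hinner : ∀ x : Fin 3 → ZMod (2 * S + 1),
      ∑ y : Fin 3 → ZMod (2 * S + 1),
          latticeConnectedCorr ρ β (2 * S + 1) (fun U => P.F (configShift (spatialVec S (x - y)) U)) P.F t =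
        sliceSumCorr ρ β S P.F P.F t := by
    intro x
    unfold sliceSumCorr
    simpa using Equiv.sum_comp (Equiv.subLeft x)
      (fun z => latticeConnectedCorr ρ β (2 * S + 1) (fun U => P.F (configShift (spatialVec S z) U)) P.F t)
  simp only [hinner, Finset.sum_const, Finset.card_univ, nsmul_eq_mul]

/-! ## §2 Reflection positivity: the zero-momentum self-correlator is non-negative and log-convex; geometric floor -/

/-- `s_S(t) ≥ 0` for a time-zero spatial species (`β ≥ 0`, `S ≥ 1`). [folklore consequence of OS positivity] -/
theorem sliceSumCorr_self_nonneg {N : ℕ} (ρ : G →* Matrix (Fin N) (Fin N) ℂ) (hρ : Continuous ρ) {β : ℝ}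
    (hβ : 0 ≤ β) {S : ℕ} (hS : 1 ≤ S) (P : YMSpecies G) (hP : ∀ e ∈ P.supp, e.1 0 = 0 ∧ e.2 ≠ 0) (t : ℕ) :
    0 ≤ sliceSumCorr ρ β S P.F P.F t := by
  have h := latticeConnectedCorr_self_nonneg ρ hρ hβ hS (sliceSpecies S P) (sliceSpecies_timeZeroSpatial S hP) t
  rw [latticeConnectedCorr_sliceSpecies ρ hρ] at h
  have hN : (0 : ℝ) < Fintype.card (Fin 3 → ZMod (2 * S + 1)) := by exact_mod_cast Fintype.card_pos
  exact (mul_nonneg_iff_of_pos_left hN).mp h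

/-- `s_S(t+1)² ≤ s_S(t) · s_S(t+2)` for `t + 2 ≤ 2S+1`, time-zero spatial species (`β ≥ 0`, `S ≥ 1`).
[folklore consequence of OS positivity] -/
theorem sliceSumCorr_self_logConvex {N : ℕ} (ρ : G →* Matrix (Fin N) (Fin N) ℂ) (hρ : Continuous ρ) {β : ℝ}
    (hβ : 0 ≤ β) {S : ℕ} (hS : 1 ≤ S) (P : YMSpecies G) (hP : ∀ e ∈ P.supp, e.1 0 = 0 ∧ e.2 ≠ 0) (t : ℕ)
    (ht : t + 2 ≤ 2 * S + 1) :
    sliceSumCorr ρ β S P.F P.F (t + 1) ^ 2 ≤ sliceSumCorr ρ β S P.F P.F t * sliceSumCorr ρ β S P.F P.F (t + 2) := by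
  have h := latticeConnectedCorr_self_logConvex ρ hρ hβ hS (sliceSpecies S P) (sliceSpecies_timeZeroSpatial S hP) t ht
  simp only [latticeConnectedCorr_sliceSpecies ρ hρ] at h
  set N : ℝ := ((Fintype.card (Fin 3 → ZMod (2 * S + 1)) : ℕ) : ℝ) with hNdef
  have hN : (0 : ℝ) < N := by rw [hNdef]; exact_mod_cast Fintype.card_pos
  have h2 : N ^ 2 * sliceSumCorr ρ β S P.F P.F (t + 1) ^ 2 ≤
      N ^ 2 * (sliceSumCorr ρ β S P.F P.F t * sliceSumCorr ρ β S P.F P.F (t + 2)) := by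
    have e1 : (N * sliceSumCorr ρ β S P.F P.F (t + 1)) ^ 2 = N ^ 2 * sliceSumCorr ρ β S P.F P.F (t + 1) ^ 2 := by
      ring
    have e2 : N * sliceSumCorr ρ β S P.F P.F t * (N * sliceSumCorr ρ β S P.F P.F (t + 2)) =
        N ^ 2 * (sliceSumCorr ρ β S P.F P.F t * sliceSumCorr ρ β S P.F P.F (t + 2)) := by ring
    rw [← e1, ← e2]; exact h
  exact le_of_mul_le_mul_left h2 (by positivity)

/-- **Geometric floor from two-point data** (discrete): a non-negative multiplicatively convex sequence on `[0, K]`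
with `a 0 ≤ s_max` and `0 < f₁ ≤ a 1` obeys `a n ≥ (f₁/s_max)^{n-1} f₁` for `1 ≤ n ≤ K` (`s_max > 0`).
[elementary; tree `mulConvex_ratio_floor` + `mulConvex_lower_envelope`] -/
theorem geometric_floor_of_two_point {a : ℕ → ℝ} {K : ℕ} (h0 : ∀ k, k ≤ K → 0 ≤ a k)
    (hconv : ∀ k, k + 2 ≤ K → a (k + 1) ^ 2 ≤ a k * a (k + 2)) {sMax f₁ : ℝ} (hsMax : 0 < sMax)
    (hf : 0 < f₁) (hmax : a 0 ≤ sMax) (hfloor : f₁ ≤ a 1) :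
    ∀ n, 1 ≤ n → n ≤ K → (f₁ / sMax) ^ (n - 1) * f₁ ≤ a n := by
  intro n hn hnK
  set θ : ℝ := f₁ / sMax with hθdef
  have hθ : 0 < θ := div_pos hf hsMax
  have hfl : θ ^ (1 - 0) * a 0 ≤ a 1 := by
    rw [Nat.sub_zero, pow_one]
    calc θ * a 0 ≤ θ * sMax := mul_le_mul_of_nonneg_left hmax hθ.le
      _ = f₁ := by rw [hθdef, div_mul_cancel₀ _ hsMax.ne']
      _ ≤ a 1 := hfloor
  have hstep : ∀ q, 1 ≤ q → q + 1 ≤ K → θ * a q ≤ a (q + 1) :=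
    mulConvex_ratio_floor h0 hconv hθ zero_lt_one hfl
  have henv := mulConvex_lower_envelope hθ.le hstep n hn hnK
  calc θ ^ (n - 1) * f₁ ≤ θ ^ (n - 1) * a 1 := mul_le_mul_of_nonneg_left hfloor (pow_nonneg hθ.le _)
    _ ≤ a n := henv

/-! ## §2b The first datum for free: `s_S(0)` is bounded uniformly in the volume (β-uniform SC clustering) -/

/-- The `t = 0` slice term in Osterwalder–Seiler form: `Cov(P∘θ_v, P) = ⟨P · P∘θ_v⟩ − ⟨P⟩⟨P∘θ_v⟩`. -/
theorem latticeConnectedCorr_shift_left_zero {N : ℕ} (ρ : G →* Matrix (Fin N) (Fin N) ℂ) (β : ℝ) (L : ℕ) [NeZero L]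
    (F : LGConfig 4 G → ℝ) (v : Fin 4 → ℤ) :
    latticeConnectedCorr ρ β L (fun U => F (configShift v U)) F 0 =
      wilsonExpectation ρ β (toTorusObservable L fun U => F U * F (configShift v U)) -
        wilsonExpectation ρ β (toTorusObservable L F) *
          wilsonExpectation ρ β (toTorusObservable L (F ∘ configShift v)) := by
  rw [latticeConnectedCorr_eq_wilsonExpectation]
  have h0 : ∀ U : LGConfig 4 G, configShift (-Pi.single (0 : Fin 4) ((0 : ℕ) : ℤ)) U = U := by
    intro U; funext e; simp [configShift_apply]
  simp only [h0, Function.comp_def, mul_comm]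

/-- **F0 — the `t = 0` datum is free.**  For every species `P` there are `β₀ > 0` and `s_max` with
`s_S(0) = Σ_{x⃗} Cov(P_{(0,x⃗)}, P) ≤ s_max` for all `0 ≤ β ≤ β₀` and ALL `S` — from the β-uniform strong-coupling
clustering `torusClustering_uniform_fixedRate` (R1's engine) and `Σ_{x⃗ ∈ 𝕋³} e^{-‖x⃗‖_∞} ≤ (Σ_{k ∈ ℤ} e^{-|k|/3})³`. -/
theorem sliceSumCorr_zero_le {N : ℕ} (ρ : G →* Matrix (Fin N) (Fin N) ℂ) (hρ : Continuous ρ) (P : YMSpecies G) :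
    ∃ β₀ sMax : ℝ, 0 < β₀ ∧ ∀ β : ℝ, 0 ≤ β → β ≤ β₀ → ∀ S : ℕ, sliceSumCorr ρ β S P.F P.F 0 ≤ sMax := by
  obtain ⟨β₀, hβ₀, h⟩ := torusClustering_uniform_fixedRate (d := 4) ρ (by norm_num) hρ
  obtain ⟨C, hC⟩ := h P.F P.F ⟨P.supp, P.isCylinder⟩ ⟨P.supp, P.isCylinder⟩ P.measurable P.measurable
    P.bounded P.bounded
  -- the geometric weight `q = e^{-1/3}`
  obtain ⟨q, hq0, hq1, hqexp⟩ : ∃ q : ℝ, 0 ≤ q ∧ q < 1 ∧ ∀ n : ℕ, Real.exp (n * (-1 / 3 : ℝ)) = q ^ n :=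
    ⟨Real.exp (-1 / 3), (Real.exp_pos _).le, Real.exp_lt_one_iff.mpr (by norm_num),
      fun n => Real.exp_nat_mul _ _⟩
  have hg0 : ∀ k : ℤ, 0 ≤ q ^ k.natAbs := fun k => pow_nonneg hq0 _
  have hgs : Summable fun k : ℤ => q ^ k.natAbs := by
    refine Summable.of_nat_of_neg ?_ ?_
    · simpa [Int.natAbs_natCast] using summable_geometric_of_lt_one hq0 hq1
    · simpa [Int.natAbs_neg, Int.natAbs_natCast] using summable_geometric_of_lt_one hq0 hq1
  have hC0 : 0 ≤ C := by
    have h1 := hC 0 le_rfl hβ₀.le 0 0 (by simp)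
    simp only [norm_zero, neg_zero, Real.exp_zero, mul_one] at h1
    exact (abs_nonneg _).trans h1
  refine ⟨β₀, C * ∏ _j : Fin 3, ∑' k : ℤ, q ^ k.natAbs, hβ₀, fun β hβ hββ₀ S => ?_⟩
  haveI : NeZero (2 * S + 1) := ⟨by omega⟩
  -- per-site bound `Cov(P_{(0,x⃗)}, P) ≤ C Π_j q^{|x_j|}`
  have hx : ∀ x : Fin 3 → ZMod (2 * S + 1),
      latticeConnectedCorr ρ β (2 * S + 1) (fun U => P.F (configShift (spatialVec S x) U)) P.F 0 ≤
        C * ∏ j : Fin 3, q ^ ((x j).valMinAbs).natAbs := by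
    intro x
    have hnorm : 2 * ‖spatialVec S x‖ < ((2 * S : ℕ) : ℝ) + 1 := by
      have hle : supNorm (spatialVec S x) ≤ S := by
        rw [supNorm_le_iff]
        intro i
        by_cases hi : i = 0
        · subst hi; simp [spatialVec]
        · simp only [spatialVec, dif_neg hi]
          have := ZMod.natAbs_valMinAbs_le (x (i.pred hi))
          omega
      rw [norm_eq_supNorm]
      have : (supNorm (spatialVec S x) : ℝ) ≤ S := by exact_mod_cast hle
      push_cast; linarith
    have key := hC β hβ hββ₀ (2 * S) (spatialVec S x) hnorm
    have hexp : Real.exp (-‖spatialVec S x‖) ≤ ∏ j : Fin 3, q ^ ((x j).valMinAbs).natAbs := by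
      have h1 : ∀ j : Fin 3, ((x j).valMinAbs).natAbs ≤ supNorm (spatialVec S x) := by
        intro j
        have := natAbs_le_supNorm (spatialVec S x) j.succ
        simpa [spatialVec, Fin.succ_ne_zero] using this
      have h2 : (∑ j : Fin 3, ((x j).valMinAbs).natAbs) ≤ 3 * supNorm (spatialVec S x) :=
        calc (∑ j : Fin 3, ((x j).valMinAbs).natAbs) ≤ ∑ _j : Fin 3, supNorm (spatialVec S x) :=
              Finset.sum_le_sum fun j _ => h1 j
          _ = 3 * supNorm (spatialVec S x) := by simp
      have hsum : ((∑ j : Fin 3, ((x j).valMinAbs).natAbs : ℕ) : ℝ) ≤ 3 * ‖spatialVec S x‖ := by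
        rw [norm_eq_supNorm]; exact_mod_cast h2
      calc Real.exp (-‖spatialVec S x‖)
          ≤ Real.exp ((∑ j : Fin 3, ((x j).valMinAbs).natAbs : ℕ) * (-1 / 3 : ℝ)) :=
            Real.exp_le_exp.mpr (by linarith)
        _ = q ^ (∑ j : Fin 3, ((x j).valMinAbs).natAbs) := hqexp _
        _ = ∏ j : Fin 3, q ^ ((x j).valMinAbs).natAbs := (Finset.prod_pow_eq_pow_sum _ _ _).symm
    calc latticeConnectedCorr ρ β (2 * S + 1) (fun U => P.F (configShift (spatialVec S x) U)) P.F 0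
        = _ := latticeConnectedCorr_shift_left_zero ρ β (2 * S + 1) P.F (spatialVec S x)
      _ ≤ _ := le_abs_self _
      _ ≤ C * Real.exp (-‖spatialVec S x‖) := key
      _ ≤ C * ∏ j : Fin 3, q ^ ((x j).valMinAbs).natAbs := mul_le_mul_of_nonneg_left hexp hC0
  -- the one-dimensional sum over `ZMod (2S+1)` against the sum over `ℤ`
  have hZ : ∑ a : ZMod (2 * S + 1), q ^ (a.valMinAbs).natAbs ≤ ∑' k : ℤ, q ^ k.natAbs := by
    have hinj : Function.Injective (ZMod.valMinAbs : ZMod (2 * S + 1) → ℤ) := by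
      intro a b hab
      have := congrArg (fun k : ℤ => (k : ZMod (2 * S + 1))) hab
      simpa [ZMod.coe_valMinAbs] using this
    calc ∑ a : ZMod (2 * S + 1), q ^ (a.valMinAbs).natAbs
        = ∑ k ∈ Finset.univ.image (ZMod.valMinAbs : ZMod (2 * S + 1) → ℤ), q ^ k.natAbs := by
          rw [Finset.sum_image fun a _ b _ hab => hinj hab]
      _ ≤ ∑' k : ℤ, q ^ k.natAbs := Summable.sum_le_tsum _ (fun k _ => hg0 k) hgs
  -- sum up
  calc sliceSumCorr ρ β S P.F P.F 0
      = ∑ x : Fin 3 → ZMod (2 * S + 1), latticeConnectedCorr ρ β (2 * S + 1)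
          (fun U => P.F (configShift (spatialVec S x) U)) P.F 0 := rfl
    _ ≤ ∑ x : Fin 3 → ZMod (2 * S + 1), C * ∏ j : Fin 3, q ^ ((x j).valMinAbs).natAbs :=
        Finset.sum_le_sum fun x _ => hx x
    _ = C * ∏ j : Fin 3, ∑ a : ZMod (2 * S + 1), q ^ (a.valMinAbs).natAbs := by
        rw [← Finset.mul_sum]
        congr 1
        exact (Fintype.prod_sum fun (_ : Fin 3) (a : ZMod (2 * S + 1)) => q ^ (a.valMinAbs).natAbs).symm
    _ ≤ C * ∏ _j : Fin 3, ∑' k : ℤ, q ^ k.natAbs := by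
        refine mul_le_mul_of_nonneg_left (Finset.prod_le_prod (fun j _ => ?_) fun j _ => hZ) hC0
        exact Finset.sum_nonneg fun a _ => hg0 _

/-! ## §3 The rate ceiling and the assembly with R1 -/

/-- **Rate ceiling.**  A geometric floor against an exponential ceiling bounds the rate: if
`q^{S-1} f₁ ≤ C e^{-m S}` for all large `S` (`0 < q`, `0 < f₁`) then `m ≤ -log q`. [elementary] -/
theorem rate_le_neg_log_of_floor {q f₁ C m : ℝ} (hq : 0 < q) (hf : 0 < f₁)
    (h : ∀ᶠ S : ℕ in atTop, q ^ (S - 1) * f₁ ≤ C * Real.exp (-(m * S))) : m ≤ -Real.log q := by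
  refine rate_le_of_eventually_exp_le (η := f₁ / q) (C := C) (u := -Real.log q) (v := m) (div_pos hf hq) ?_
  filter_upwards [h, eventually_ge_atTop 1] with S hS hS1
  have hqS : q ^ S = q * q ^ (S - 1) := by
    rw [← pow_succ']; congr 1; omega
  have hexp : Real.exp (-(-Real.log q * S)) = q ^ S := by
    rw [neg_mul, neg_neg, mul_comm, Real.exp_nat_mul, Real.exp_log hq]
  calc f₁ / q * Real.exp (-(-Real.log q * S)) = f₁ / q * (q * q ^ (S - 1)) := by rw [hexp, hqS]
    _ = q ^ (S - 1) * f₁ := by rw [← mul_assoc, div_mul_cancel₀ _ hq.ne']; ring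
    _ ≤ C * Real.exp (-(m * S)) := hS

/-- **R2, the RP / transfer-matrix half — PROVED: `SliceFloorSC → NoLightMoversSCTransfer`.**
Window `β₀ := min(β₀^{floor}, β₀^{R1})`, `β₁ := β₀/2`; with the floor data `(s_max, f₁)` at `β₁`,
`q := f₁ / max(s_max, f₁)`, `L := -log q`, `θ := c / max(L, c)`: every valid zero-momentum rate obeys `m(β) ≤ L`
(geometric floor `s_{S}(S) ≥ q^{S-1} f₁` from RP log-convexity vs. the hypothesis at `(P, P)`, `t = S`), hence
`θ m(β) ≤ c` and R1's β-uniform point clustering at rate `c` concludes (`S₃ := 0`). -/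
theorem noLightMoversSCTransfer_of_sliceFloorSC (hfl : SliceFloorSC) : NoLightMoversSCTransfer := by
  intro G _ _ _ _ hG
  letI : MeasurableSpace G := borel G
  haveI : BorelSpace G := ⟨rfl⟩
  intro r
  -- the SC two-point floor and R1
  obtain ⟨β₀f, hβ₀f, P, hP, hwin⟩ := hfl G hG r
  obtain ⟨β₀R, c, hβ₀R, hc, hR1⟩ := noLightMoversSC_holds G hG r
  -- the window
  set β₀ : ℝ := min β₀f β₀R with hβ₀def
  have hβ₀ : 0 < β₀ := lt_min hβ₀f hβ₀R
  set β₁ : ℝ := β₀ / 2 with hβ₁def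
  have hβ₁ : 0 < β₁ := by positivity
  have hβ₁β₀ : β₁ < β₀ := by rw [hβ₁def]; linarith
  have hβ₁f : β₁ < β₀f := hβ₁β₀.trans_le (min_le_left _ _)
  obtain ⟨sMax, f₁, S₀, hf₁, hSF⟩ := hwin β₁ hβ₁ hβ₁f
  -- the constants
  set sMax' : ℝ := max sMax f₁ with hsMax'def
  have hsMax' : 0 < sMax' := hf₁.trans_le (le_max_right _ _)
  set q : ℝ := f₁ / sMax' with hqdef
  have hq : 0 < q := div_pos hf₁ hsMax'
  set L : ℝ := -Real.log q with hLdef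
  set M : ℝ := max L c with hMdef
  have hM : 0 < M := hc.trans_le (le_max_right _ _)
  set θ : ℝ := c / M with hθdef
  have hθ : 0 < θ := div_pos hc hM
  refine ⟨β₁, β₀, θ, hβ₁, hβ₁β₀, hθ, fun m S₁ hm hHyp => ⟨fun _ => 0, fun A B => ?_⟩⟩
  obtain ⟨C, hC⟩ := hR1 A B
  refine ⟨C, fun β hβ₁le hβle S t _ ht => ?_⟩
  have hβpos : 0 < β := hβ₁.trans_le hβ₁le
  have hβR : β ≤ β₀R := hβle.trans (min_le_right _ _)
  have hβf : β ≤ β₀f := hβle.trans (min_le_left _ _)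
  -- RATE CEILING `m β ≤ L`: the geometric floor at `t = S'` against the hypothesis at `(P, P)`, `t = S'`
  have hmL : m β ≤ L := by
    obtain ⟨CP, hCP⟩ := hHyp P P
    refine rate_le_neg_log_of_floor (C := CP) hq hf₁ ?_
    filter_upwards [eventually_ge_atTop (max (max (S₁ β) S₀) 1)] with S' hS'
    have hS'1 : 1 ≤ S' := le_trans (le_max_right _ _) hS'
    have hS'0 : S₀ ≤ S' := le_trans (le_trans (le_max_right _ _) (le_max_left _ _)) hS'
    have hS'1' : S₁ β ≤ S' := le_trans (le_trans (le_max_left _ _) (le_max_left _ _)) hS'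
    obtain ⟨h0S, h1S⟩ := hSF β hβ₁le hβf S' hS'0
    have hfloor := geometric_floor_of_two_point (a := fun k => sliceSumCorr r.ρ β S' P.F P.F k) (K := 2 * S' + 1)
      (fun k _ => sliceSumCorr_self_nonneg r.ρ r.continuous hβpos.le hS'1 P hP k)
      (fun k hk => sliceSumCorr_self_logConvex r.ρ r.continuous hβpos.le hS'1 P hP k hk)
      hsMax' hf₁ (h0S.trans (le_max_left _ _)) h1S S' hS'1 (by omega)
    have hceil := (le_abs_self _).trans (hCP β hβ₁le hβle S' S' hS'1' le_rfl)
    exact hfloor.trans hceil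
  -- hence `θ · m β ≤ c`
  have hθm : θ * m β ≤ c := by
    have h1 : m β ≤ M := hmL.trans (le_max_left _ _)
    have h2 : m β / M ≤ 1 := (div_le_one hM).mpr h1
    calc θ * m β = c * (m β / M) := by rw [hθdef]; ring
      _ ≤ c * 1 := mul_le_mul_of_nonneg_left h2 hc.le
      _ = c := mul_one c
  -- R1 and monotonicity of the exponential
  have hC0 : 0 ≤ C := by
    have h := hC β hβpos hβR 0 0 le_rfl
    simp only [Nat.cast_zero, mul_zero, neg_zero, Real.exp_zero, mul_one] at h
    exact (abs_nonneg _).trans h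
  calc |latticeConnectedCorr r.ρ β (2 * S + 1) A.F B.F t| ≤ C * Real.exp (-(c * t)) := hC β hβpos hβR S t ht
    _ ≤ C * Real.exp (-(θ * m β * t)) := by
        refine mul_le_mul_of_nonneg_left (Real.exp_le_exp.mpr ?_) hC0
        have : θ * m β * t ≤ c * t := mul_le_mul_of_nonneg_right hθm (Nat.cast_nonneg t)
        linarith

/-! ## §3b Smaller SC inputs: by F0 only the floor on `s_S(1)` is needed -/

/-- **SC INPUT, one-clause form.**  As `SliceFloorSC` without the `s_S(0) ≤ s_max` clause (free by F0
`sliceSumCorr_zero_le`): a time-zero spatial species `P` whose nearest-neighbour slice sum has a positive floor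
`f₁(β₁) ≤ s_S(1)` on `[β₁, β₀]` for all large `S`. -/
def SliceOneFloorSC : Prop :=
  ∀ (G : Type) [Group G] [TopologicalSpace G] [IsTopologicalGroup G] [CompactSpace G],
    IsCompactSimpleLieGroup G → letI : MeasurableSpace G := borel G; haveI : BorelSpace G := ⟨rfl⟩;
    ∀ r : LatticeRep G, ∃ β₀ : ℝ, 0 < β₀ ∧ ∃ P : YMSpecies G, (∀ e ∈ P.supp, e.1 0 = 0 ∧ e.2 ≠ 0) ∧
      ∀ β₁ : ℝ, 0 < β₁ → β₁ < β₀ → ∃ f₁ : ℝ, ∃ S₀ : ℕ, 0 < f₁ ∧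
        ∀ β : ℝ, β₁ ≤ β → β ≤ β₀ → ∀ S : ℕ, S₀ ≤ S → f₁ ≤ sliceSumCorr r.ρ β S P.F P.F 1

/-- **SC INPUT, power-law form (the shape the `SCFloor` engine produces).**  A time-zero spatial species `P`
(intended: a spatial plaquette) with `c β^k ≤ s_S(1)` for `0 < β ≤ β₀`, `S ≥ S₀` (intended `k = 4`: the LANDED
facing floor `SCFloor.facingPlaquetteCorr_floor` gives `c β⁴ ≤ Cov(P_{e₀}, P)`; what remains is that the other
slice terms `Σ_{x⃗ ≠ 0} Cov(P_{(1,x⃗)}, P)` do not eat more than half of it). -/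
def SlicePowerFloorSC : Prop :=
  ∀ (G : Type) [Group G] [TopologicalSpace G] [IsTopologicalGroup G] [CompactSpace G],
    IsCompactSimpleLieGroup G → letI : MeasurableSpace G := borel G; haveI : BorelSpace G := ⟨rfl⟩;
    ∀ r : LatticeRep G, ∃ β₀ c : ℝ, ∃ k S₀ : ℕ, 0 < β₀ ∧ 0 < c ∧
      ∃ P : YMSpecies G, (∀ e ∈ P.supp, e.1 0 = 0 ∧ e.2 ≠ 0) ∧
        ∀ β : ℝ, 0 < β → β ≤ β₀ → ∀ S : ℕ, S₀ ≤ S → c * β ^ k ≤ sliceSumCorr r.ρ β S P.F P.F 1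

theorem sliceOneFloorSC_of_slicePowerFloorSC (h : SlicePowerFloorSC) : SliceOneFloorSC := by
  intro G _ _ _ _ hG
  letI : MeasurableSpace G := borel G
  haveI : BorelSpace G := ⟨rfl⟩
  intro r
  obtain ⟨β₀, c, k, S₀, hβ₀, hc, P, hP, hfl⟩ := h G hG r
  refine ⟨β₀, hβ₀, P, hP, fun β₁ hβ₁ _ => ⟨c * β₁ ^ k, S₀, by positivity, fun β hβ₁le hβle S hS => ?_⟩⟩
  calc c * β₁ ^ k ≤ c * β ^ k := mul_le_mul_of_nonneg_left (pow_le_pow_left₀ hβ₁.le hβ₁le k) hc.le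
    _ ≤ sliceSumCorr r.ρ β S P.F P.F 1 := hfl β (hβ₁.trans_le hβ₁le) hβle S hS

theorem sliceFloorSC_of_sliceOneFloorSC (h : SliceOneFloorSC) : SliceFloorSC := by
  intro G _ _ _ _ hG
  letI : MeasurableSpace G := borel G
  haveI : BorelSpace G := ⟨rfl⟩
  intro r
  obtain ⟨β₀, hβ₀, P, hP, hwin⟩ := h G hG r
  obtain ⟨β₀c, sMax, hβ₀c, hs0⟩ := sliceSumCorr_zero_le r.ρ r.continuous P
  refine ⟨min β₀ β₀c, lt_min hβ₀ hβ₀c, P, hP, fun β₁ hβ₁ hβ₁lt => ?_⟩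
  obtain ⟨f₁, S₀, hf₁, hfl⟩ := hwin β₁ hβ₁ (hβ₁lt.trans_le (min_le_left _ _))
  exact ⟨sMax, f₁, S₀, hf₁, fun β hβ₁le hβle S hS =>
    ⟨hs0 β (hβ₁.le.trans hβ₁le) (hβle.trans (min_le_right _ _)) S,
      hfl β hβ₁le (hβle.trans (min_le_left _ _)) S hS⟩⟩

/-- **R2 from the one-clause floor.** -/
theorem noLightMoversSCTransfer_of_sliceOneFloorSC (h : SliceOneFloorSC) : NoLightMoversSCTransfer :=
  noLightMoversSCTransfer_of_sliceFloorSC (sliceFloorSC_of_sliceOneFloorSC h)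

/-- **R2 from the power-law floor** — the form to be supplied by the `SCFloor` engine. -/
theorem noLightMoversSCTransfer_of_slicePowerFloorSC (h : SlicePowerFloorSC) : NoLightMoversSCTransfer :=
  noLightMoversSCTransfer_of_sliceOneFloorSC (sliceOneFloorSC_of_slicePowerFloorSC h)

/-! ## §3c The concrete target for the `SCFloor` engine: the spatial plaquette `Re tr ρ(U_{(0;1,2)})` -/

/-- The slice sum splits as the diagonal (`x⃗ = 0`) term plus the off-diagonal terms. -/
theorem sliceSumCorr_split {N : ℕ} (ρ : G →* Matrix (Fin N) (Fin N) ℂ) (β : ℝ) (S : ℕ) (A B : LGConfig 4 G → ℝ)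
    (t : ℕ) :
    sliceSumCorr ρ β S A B t = latticeConnectedCorr ρ β (2 * S + 1) A B t +
      ∑ x ∈ (Finset.univ : Finset (Fin 3 → ZMod (2 * S + 1))).erase 0,
        latticeConnectedCorr ρ β (2 * S + 1) (fun U => A (configShift (spatialVec S x) U)) B t := by
  have h0 : ∀ U : LGConfig 4 G, configShift (spatialVec S 0) U = U := by
    intro U; funext e; simp [configShift_apply]
  have h1 : (fun U : LGConfig 4 G => A (configShift (spatialVec S 0) U)) = A := funext fun U => by rw [h0]
  unfold sliceSumCorr
  rw [← Finset.add_sum_erase _ _ (Finset.mem_univ (0 : Fin 3 → ZMod (2 * S + 1))), h1]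

/-- **SC INPUT (F), facing floor on odd tori** — this is `SCFloor.facingPlaquetteCorr_floor` (ym-ir-line-bsf-p1, LANDED
p606286: `c β⁴ ≤ Cov(P_{e₀}, P) ≤ C β⁴`, all `L ≥ 3`, `0 < β ≤ β₀`) restricted to the odd tori `L = 2S+1`, `S ≥ 1`,
modulo its hypothesis `∃ g h, Re tr ρ g ≠ Re tr ρ h` (true for `r : LatticeRep G`, `G` compact simple: a faithful
continuous representation of a non-trivial compact group has a non-constant real character — to be discharged). -/
def PlaquetteFacingFloorSC : Prop :=
  ∀ (G : Type) [Group G] [TopologicalSpace G] [IsTopologicalGroup G] [CompactSpace G],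
    IsCompactSimpleLieGroup G → letI : MeasurableSpace G := borel G; haveI : BorelSpace G := ⟨rfl⟩;
    ∀ r : LatticeRep G, ∃ β₀ c : ℝ, 0 < β₀ ∧ 0 < c ∧
      ∀ S : ℕ, 1 ≤ S → ∀ β : ℝ, 0 < β → β ≤ β₀ →
        c * β ^ 4 ≤ latticeConnectedCorr r.ρ β (2 * S + 1) (plaquetteObs r.ρ 0 1 2) (plaquetteObs r.ρ 0 1 2) 1

/-- **SC INPUT (O), the off-diagonal slice terms are `O(β⁵)` UNIFORMLY IN THE VOLUME** — the one estimate left: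
`|Σ_{x⃗ ≠ 0} Cov(P_{(0,x⃗)}, P_{e₀})| ≤ C β⁵` for `0 < β ≤ β₀` and all `S ≥ S₀` (per pair: no polymer with `≤ 4`
plaquettes joins a non-facing pair, `SCFloor.mayer_sum_offdiag`; summability in `x⃗` uniformly in `S`: the vanishing
order / activity power grows with `‖x⃗‖_∞`).  A per-pair `O(β⁵)` bound with an `x⃗`-independent constant is NOT enough. -/
def PlaquetteOffDiagSliceSC : Prop :=
  ∀ (G : Type) [Group G] [TopologicalSpace G] [IsTopologicalGroup G] [CompactSpace G],
    IsCompactSimpleLieGroup G → letI : MeasurableSpace G := borel G; haveI : BorelSpace G := ⟨rfl⟩;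
    ∀ r : LatticeRep G, ∃ β₀ C : ℝ, ∃ S₀ : ℕ, 0 < β₀ ∧
      ∀ β : ℝ, 0 < β → β ≤ β₀ → ∀ S : ℕ, S₀ ≤ S →
        |sliceSumCorr r.ρ β S (plaquetteObs r.ρ 0 1 2) (plaquetteObs r.ρ 0 1 2) 1 -
            latticeConnectedCorr r.ρ β (2 * S + 1) (plaquetteObs r.ρ 0 1 2) (plaquetteObs r.ρ 0 1 2) 1| ≤
          C * β ^ 5

/-- **SC INPUT, concrete power-law form**: `c β⁴ ≤ s_S(1)` for the spatial plaquette, `0 < β ≤ β₀`, `S ≥ S₀`. -/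
def PlaquetteSlicePowerFloorSC : Prop :=
  ∀ (G : Type) [Group G] [TopologicalSpace G] [IsTopologicalGroup G] [CompactSpace G],
    IsCompactSimpleLieGroup G → letI : MeasurableSpace G := borel G; haveI : BorelSpace G := ⟨rfl⟩;
    ∀ r : LatticeRep G, ∃ β₀ c : ℝ, ∃ S₀ : ℕ, 0 < β₀ ∧ 0 < c ∧
      ∀ β : ℝ, 0 < β → β ≤ β₀ → ∀ S : ℕ, S₀ ≤ S →
        c * β ^ 4 ≤ sliceSumCorr r.ρ β S (plaquetteObs r.ρ 0 1 2) (plaquetteObs r.ρ 0 1 2) 1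

/-- (F) + (O) ⇒ the power-law slice floor, with constant `c/2` on `β ≤ min(β₀^F, β₀^O, c/(2 max(C,1)))`. -/
theorem plaquetteSlicePowerFloorSC_of_facing_offdiag (hf : PlaquetteFacingFloorSC) (ho : PlaquetteOffDiagSliceSC) :
    PlaquetteSlicePowerFloorSC := by
  intro G _ _ _ _ hG
  letI : MeasurableSpace G := borel G
  haveI : BorelSpace G := ⟨rfl⟩
  intro r
  obtain ⟨β₀f, c, hβ₀f, hc, hfl⟩ := hf G hG r
  obtain ⟨β₀o, C, S₀, hβ₀o, hoff⟩ := ho G hG r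
  set Cp : ℝ := max C 1 with hCp
  have hCp0 : 0 < Cp := lt_of_lt_of_le one_pos (le_max_right _ _)
  refine ⟨min (min β₀f β₀o) (c / (2 * Cp)), c / 2, max S₀ 1, lt_min (lt_min hβ₀f hβ₀o) (by positivity),
    by positivity, fun β hβ hβle S hS => ?_⟩
  have hβf : β ≤ β₀f := hβle.trans ((min_le_left _ _).trans (min_le_left _ _))
  have hβo : β ≤ β₀o := hβle.trans ((min_le_left _ _).trans (min_le_right _ _))
  have hβc : β ≤ c / (2 * Cp) := hβle.trans (min_le_right _ _)
  have hS1 : 1 ≤ S := le_trans (le_max_right _ _) hS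
  have hS0 : S₀ ≤ S := le_trans (le_max_left _ _) hS
  have h1 := hfl S hS1 β hβ hβf
  have h2 := (abs_le.mp (hoff β hβ hβo S hS0)).1
  have h3 : C * β ^ 5 ≤ c / 2 * β ^ 4 := by
    have hCle : C ≤ Cp := le_max_left _ _
    have hb4 : 0 ≤ β ^ 4 := by positivity
    have hCpβ : Cp * β ≤ c / 2 := by
      rw [le_div_iff₀ (by positivity)] at hβc
      linarith
    calc C * β ^ 5 ≤ Cp * β ^ 5 := mul_le_mul_of_nonneg_right hCle (by positivity)
      _ = (Cp * β) * β ^ 4 := by ring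
      _ ≤ (c / 2) * β ^ 4 := mul_le_mul_of_nonneg_right hCpβ hb4
  linarith

/-- The spatial plaquette species `plaquetteObservable ρ _ 1 2` is time-zero spatial. -/
theorem plaquetteObservable_one_two_timeZeroSpatial [SecondCountableTopology G] {N : ℕ}
    (ρ : G →* Matrix (Fin N) (Fin N) ℂ) (hρ : Continuous ρ) :
    ∀ e ∈ (plaquetteObservable ρ hρ (1 : Fin 4) 2).supp, e.1 0 = 0 ∧ e.2 ≠ 0 := by
  intro e he
  simp only [plaquetteObservable, originPlaquetteSupport, Finset.mem_insert, Finset.mem_singleton] at he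
  rcases he with rfl | rfl | rfl | rfl <;> simp

theorem slicePowerFloorSC_of_plaquette (h : PlaquetteSlicePowerFloorSC) : SlicePowerFloorSC := by
  intro G _ _ _ _ hG
  letI : MeasurableSpace G := borel G
  haveI : BorelSpace G := ⟨rfl⟩
  intro r
  haveI : SecondCountableTopology G :=
    (r.continuous.isClosedEmbedding r.injective).isEmbedding.secondCountableTopology
  obtain ⟨β₀, c, S₀, hβ₀, hc, hfl⟩ := h G hG r
  exact ⟨β₀, c, 4, S₀, hβ₀, hc, plaquetteObservable r.ρ r.continuous 1 2,
    plaquetteObservable_one_two_timeZeroSpatial r.ρ r.continuous, hfl⟩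

/-- **R2 from the concrete plaquette floor.** -/
theorem noLightMoversSCTransfer_of_plaquetteSlicePowerFloorSC (h : PlaquetteSlicePowerFloorSC) :
    NoLightMoversSCTransfer :=
  noLightMoversSCTransfer_of_slicePowerFloorSC (slicePowerFloorSC_of_plaquette h)

/-- **R2 = RP/TM (this file) + F0 (this file) + (F) facing floor (LANDED modulo `hnc`) + (O) off-diagonal `O(β⁵)`
(the engine's one remaining estimate).** -/
theorem noLightMoversSCTransfer_of_facing_offdiag (hf : PlaquetteFacingFloorSC) (ho : PlaquetteOffDiagSliceSC) :
    NoLightMoversSCTransfer :=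
  noLightMoversSCTransfer_of_plaquetteSlicePowerFloorSC (plaquetteSlicePowerFloorSC_of_facing_offdiag hf ho)

/-! ## §3d (F) is a THEOREM: the landed facing floor + non-constancy of the real character of a faithful rep -/

omit [IsTopologicalGroup G] [MeasurableSpace G] [BorelSpace G] in
/-- For a faithful unitary `r : LatticeRep G` of a compact simple (hence non-abelian, hence non-trivial) group the real
character `g ↦ Re tr r.ρ g` is NOT constant: `Re tr ρ(a) < N = Re tr ρ(1)` for `a ≠ 1`, by
`N − Re tr X = ½ ‖X − 1‖²_F` (tree `OneLinkTraceShift.card_sub_re_trace_eq`) and faithfulness. -/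
theorem LatticeRep.exists_re_trace_ne (hG : IsCompactSimpleLieGroup G) (r : LatticeRep G) :
    ∃ g h : G, (r.ρ g).trace.re ≠ (r.ρ h).trace.re := by
  obtain ⟨⟨_, ⟨a, b, hab⟩, _⟩, _⟩ := hG
  have ha : a ≠ 1 := by rintro rfl; simp at hab
  refine ⟨a, 1, fun h => ha ?_⟩
  have hN : (r.ρ a).trace.re = (r.N : ℝ) := by
    rw [map_one, Matrix.trace_one, Fintype.card_fin] at h
    simpa using h
  have hfrob := OneLinkTraceShift.card_sub_re_trace_eq (r.mem_unitary a)
  rw [hN, sub_self] at hfrob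
  have hsq : frobNorm (r.ρ a - 1) ^ 2 = 0 := by linarith
  rw [frobNorm_sq] at hsq
  have hzero : r.ρ a - 1 = 0 := by
    ext i j
    have hi := (Finset.sum_eq_zero_iff_of_nonneg (fun i _ => Finset.sum_nonneg fun j _ => by positivity)).1 hsq i
      (Finset.mem_univ _)
    have hij := (Finset.sum_eq_zero_iff_of_nonneg (fun j _ => by positivity)).1 hi j (Finset.mem_univ _)
    simpa using hij
  exact r.injective ((sub_eq_zero.mp hzero).trans (map_one r.ρ).symm)

/-- **(F) PROVED**: `PlaquetteFacingFloorSC` holds — the `SCFloor` engine's LANDED facing-plaquette floor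
`SCFloor.facingPlaquetteCorr_floor` (ym-ir-line-bsf-p1, p606286) on the odd tori `2S+1 ≥ 3`, its character hypothesis
discharged by `LatticeRep.exists_re_trace_ne`. -/
theorem plaquetteFacingFloorSC_holds : PlaquetteFacingFloorSC := by
  intro G _ _ _ _ hG
  letI : MeasurableSpace G := borel G
  haveI : BorelSpace G := ⟨rfl⟩
  intro r
  haveI : SecondCountableTopology G :=
    (r.continuous.isClosedEmbedding r.injective).isEmbedding.secondCountableTopology
  haveI : T2Space G := (r.continuous.isClosedEmbedding r.injective).isEmbedding.t2Space
  obtain ⟨β₀, c, C, hβ₀, hc, -, h⟩ :=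
    SCFloor.facingPlaquetteCorr_floor r.ρ r.continuous (LatticeRep.exists_re_trace_ne hG r)
  refine ⟨β₀, c, hβ₀, hc, fun S hS β hβ hββ₀ => ?_⟩
  haveI : NeZero (2 * S + 1) := ⟨by omega⟩
  exact (h (2 * S + 1) (by omega) β hβ hββ₀).1

/-- **R2 ⇐ (O) alone.**  With RP/TM (§1–§3), F0 (§2b) and (F) (§3d) proved, the registered stub
`stub_noLightMoversSCTransfer` of line `momentum-pincer` follows from the single strong-coupling estimate
`PlaquetteOffDiagSliceSC`: `|Σ_{x⃗ ≠ 0} Cov(P_{(0,x⃗)}, P_{e₀})| ≤ C β⁵` uniformly in the volume. -/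
theorem noLightMoversSCTransfer_of_offdiag (ho : PlaquetteOffDiagSliceSC) : NoLightMoversSCTransfer :=
  noLightMoversSCTransfer_of_facing_offdiag plaquetteFacingFloorSC_holds ho

/-! ## §4 Splitting (O): the FAR field is free (activity-carrying SC clustering); only NEAR pairs remain

`PlaquetteOffDiagSliceSC` sums `Cov(P_{(0,x⃗)}, P_{e₀})` over all `x⃗ ≠ 0` of the spatial torus.  The Osterwalder–Seiler
polymer bound behind R1's engine actually gives `|Cov(F₁, F₂∘θ_x)| ≤ K (β/r)^{‖x‖_∞ − c}` (the full small-β ACTIVITY, not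
only a fixed rate), uniformly in the volume; summed over `‖x⃗‖_∞ ≥ c + k` this is `O(β^k)` uniformly in `S`.  Hence the
far field of (O) is a theorem (§4b–§4c) and (O) reduces to finitely many NEAR pairs (§4d, `PlaquetteNearPairSC`):
for each fixed spatial displacement `a ≠ 0`, `|Cov(P_{(0,a)}, P_{e₀})| ≤ C_a β⁵` uniformly in the volume. -/

/-- The slice term at time `t` in the engine's form, with ONE displacement `w` (`w + v = -t e₀`) carried by `B`:
`Cov(A∘θ_v, B; t) = ⟨A · B∘θ_w⟩ − ⟨A⟩⟨B⟩` (translation invariance of the torus Wilson measure). -/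
theorem latticeConnectedCorr_shift_left {N : ℕ} (ρ : G →* Matrix (Fin N) (Fin N) ℂ) (β : ℝ) (L : ℕ) [NeZero L]
    (A B : LGConfig 4 G → ℝ) (v w : Fin 4 → ℤ) (t : ℕ) (hw : w + v = -Pi.single 0 (t : ℤ)) :
    latticeConnectedCorr ρ β L (fun U => A (configShift v U)) B t =
      wilsonExpectation ρ β (toTorusObservable L fun U => A U * B (configShift w U)) -
        wilsonExpectation ρ β (toTorusObservable L A) * wilsonExpectation ρ β (toTorusObservable L B) := by
  have step : latticeConnectedCorr ρ β L (fun U => A (configShift v U)) B t =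
      wilsonExpectation ρ β (toTorusObservable L ((fun U => A U * B (configShift w U)) ∘ configShift v)) -
        wilsonExpectation ρ β (toTorusObservable L (A ∘ configShift v)) *
          wilsonExpectation ρ β (toTorusObservable L B) := by
    rw [latticeConnectedCorr_eq_wilsonExpectation]
    simp only [Function.comp_def, configShift_configShift, hw]
  rw [step, toTorusObservable_comp_configShift, wilsonExpectation_comp_torusConfigShift,
    toTorusObservable_comp_configShift, wilsonExpectation_comp_torusConfigShift]

/-- The combined displacement `w = -t e₀ - v_x` of the slice term at `(t, x⃗)`. -/
def farVec (S t : ℕ) (x : Fin 3 → ZMod (2 * S + 1)) : Fin 4 → ℤ :=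
  -Pi.single (0 : Fin 4) (t : ℤ) - spatialVec S x

theorem farVec_add (S t : ℕ) (x : Fin 3 → ZMod (2 * S + 1)) :
    farVec S t x + spatialVec S x = -Pi.single 0 (t : ℤ) := by
  simp [farVec]

theorem farVec_apply_zero (S t : ℕ) (x : Fin 3 → ZMod (2 * S + 1)) : farVec S t x 0 = -(t : ℤ) := by
  simp [farVec, spatialVec]

theorem farVec_apply_of_ne (S t : ℕ) (x : Fin 3 → ZMod (2 * S + 1)) {i : Fin 4} (hi : i ≠ 0) :
    farVec S t x i = -(spatialVec S x i) := by
  simp [farVec, Pi.single_eq_of_ne hi]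

/-- The combined displacement dominates the spatial one in sup-norm … -/
theorem supNorm_spatialVec_le_supNorm_farVec (S t : ℕ) (x : Fin 3 → ZMod (2 * S + 1)) :
    supNorm (spatialVec S x) ≤ supNorm (farVec S t x) := by
  rw [supNorm_le_iff]
  intro i
  by_cases hi : i = 0
  · subst hi; simp [spatialVec]
  · have h := natAbs_le_supNorm (farVec S t x) i
    rwa [farVec_apply_of_ne S t x hi, Int.natAbs_neg] at h

/-- … and is at most `S` when `t ≤ S`. -/
theorem supNorm_farVec_le (S t : ℕ) (ht : t ≤ S) (x : Fin 3 → ZMod (2 * S + 1)) :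
    supNorm (farVec S t x) ≤ S := by
  rw [supNorm_le_iff]
  intro i
  by_cases hi : i = 0
  · subst hi; rw [farVec_apply_zero, Int.natAbs_neg]; simpa using ht
  · rw [farVec_apply_of_ne S t x hi, Int.natAbs_neg]
    simp only [spatialVec, dif_neg hi]
    have := ZMod.natAbs_valMinAbs_le (x (i.pred hi))
    omega

section Engine

variable {d : ℕ}

/-- **Osterwalder–Seiler torus clustering with the full activity** (uniform in the volume, the displacement and the
coupling `0 ≤ β ≤ r`, `r = betaOne d ρ / 2`): for local bounded measurable `F₁, F₂` there are `K ≥ 0` and a range `c`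
with `|⟨F₁ (F₂∘θ_x)⟩ − ⟨F₁⟩⟨F₂∘θ_x⟩| ≤ K (β/r)^{‖x‖_∞ − c}` on every torus of side `L + 1 > 2‖x‖`, whenever `‖x‖_∞ > c`.
Same replica/polymer bound `PlaqSystem.norm_truncatedExpect_le` as R1's `torusClustering_uniform_fixedRate`, without
trading the activity `(β/r)^n` for `e^{-n}`. -/
theorem torusClustering_uniform_activity {N : ℕ} (ρ : G →* Matrix (Fin N) (Fin N) ℂ) (hd : 2 ≤ d)
    (hρ : Continuous ρ) :
    ∃ r : ℝ, 0 < r ∧ ∀ F₁ F₂ : LGConfig d G → ℝ,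
      Literature.MathematicalPhysics.QuantumLattice.IsLocalObservable F₁ →
      Literature.MathematicalPhysics.QuantumLattice.IsLocalObservable F₂ →
      Measurable F₁ → Measurable F₂ → (∃ C, ∀ U, |F₁ U| ≤ C) → (∃ C, ∀ U, |F₂ U| ≤ C) →
        ∃ (K : ℝ) (c : ℕ), 0 ≤ K ∧ ∀ β : ℝ, 0 ≤ β → β ≤ r →
          ∀ (L : ℕ) (x : Literature.Probability.LatticeModels.Site d), 2 * ‖x‖ < (L : ℝ) + 1 →
            c < supNorm x →
            |wilsonExpectation (L := L + 1) ρ β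
                  (toTorusObservable (L + 1) fun U => F₁ U * F₂ (configShift x U)) -
                wilsonExpectation (L := L + 1) ρ β (toTorusObservable (L + 1) F₁) *
                  wilsonExpectation (L := L + 1) ρ β
                    (toTorusObservable (L + 1) (F₂ ∘ configShift x))| ≤
              K * (β / r) ^ (supNorm x - c) := by
  classical
  haveI : NeZero d := ⟨by omega⟩
  set r : ℝ := betaOne d ρ / 2 with hrdef
  have hr : 0 < r := by have := betaOne_pos d (ρ := ρ); positivity
  have hrR : r < betaOne d ρ := by have := betaOne_pos d (ρ := ρ); rw [hrdef]; linarith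
  refine ⟨r, hr, fun F₁ F₂ hloc₁ hloc₂ h₁m h₂m hb₁ hb₂ => ?_⟩
  obtain ⟨B₁, hB₁⟩ := hloc₁
  obtain ⟨S₂, hS₂⟩ := hloc₂
  obtain ⟨C₁, hC₁⟩ := hb₁
  obtain ⟨C₂, hC₂⟩ := hb₂
  have hC₁0 : 0 ≤ C₁ := (abs_nonneg _).trans (hC₁ fun _ => 1)
  have hC₂0 : 0 ≤ C₂ := (abs_nonneg _).trans (hC₂ fun _ => 1)
  set c : ℕ := bondRadius B₁ + bondRadius S₂ + 2 with hcdef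
  set sB : ℕ := (B₁.card + S₂.card) * (2 ^ d * (d * d)) with hsB
  set κ : ℝ := 2 * Real.exp (1 / 2) with hκ
  have hκ1 : 1 ≤ κ := by
    rw [hκ]; have := Real.one_lt_exp_iff.2 (by norm_num : (0 : ℝ) < 1 / 2); linarith
  set Kunif : ℝ := C₁ * C₂ * κ ^ sB + C₁ * κ ^ sB * (C₂ * κ ^ sB) with hKunif
  have hKunif0 : 0 ≤ Kunif := by positivity
  refine ⟨Kunif, c, hKunif0, fun β hβ0 hβr L x hx hfar => ?_⟩
  set L' : ℕ := L + 1 with hL'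
  have hR : (torusSystem (d := d) (G := G) ρ L').Regular (costBound ρ) (Plaq.degBound d) :=
    torusSystem_regular ρ hρ
  set X₀ : ℕ := supNorm x with hX₀
  have hxn : ‖x‖ = (X₀ : ℝ) := norm_eq_supNorm x
  have hx' : 2 * X₀ < L' := by
    have h : (2 : ℝ) * X₀ < (L : ℝ) + 1 := by rwa [hxn] at hx
    exact_mod_cast h
  set Φ₁ : ZdGaugeConfig d G → ℂ := fun U => (F₁ (U ∘ torusRed L') : ℂ) with hΦ₁
  set Φ₂ : ZdGaugeConfig d G → ℂ := fun U => (F₂ (configShift x (U ∘ torusRed L')) : ℂ) with hΦ₂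
  set B₂ : Finset (Literature.MathematicalPhysics.QuantumFieldTheory.ZdEdge d) :=
    S₂.image fun e => (e.1 - x, e.2) with hB₂
  have hΦ₁m : Measurable Φ₁ :=
    Complex.measurable_ofReal.comp (h₁m.comp (measurable_comp_relabel (torusRed L')))
  have hΦ₂m : Measurable Φ₂ :=
    Complex.measurable_ofReal.comp ((h₂m.comp (configShift x).measurable).comp
      (measurable_comp_relabel (torusRed L')))
  have hΦ₁b : ∀ U, ‖Φ₁ U‖ ≤ C₁ := fun U => by
    rw [hΦ₁, Complex.norm_real, Real.norm_eq_abs]; exact hC₁ _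
  have hΦ₂b : ∀ U, ‖Φ₂ U‖ ≤ C₂ := fun U => by
    rw [hΦ₂, Complex.norm_real, Real.norm_eq_abs]; exact hC₂ _
  have hΦ₁d : DependsOn Φ₁
      ((B₁.image (torusRed L') : Finset (Literature.MathematicalPhysics.QuantumFieldTheory.ZdEdge d)) :
        Set (Literature.MathematicalPhysics.QuantumFieldTheory.ZdEdge d)) :=
    dependsOn_comp_torusRed L' (F := fun U => (F₁ U : ℂ)) fun U V h => by
      show (F₁ U : ℂ) = F₁ V; rw [hB₁ h]
  have hΦ₂d : DependsOn Φ₂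
      ((B₂.image (torusRed L') : Finset (Literature.MathematicalPhysics.QuantumFieldTheory.ZdEdge d)) :
        Set (Literature.MathematicalPhysics.QuantumFieldTheory.ZdEdge d)) := by
    have h := IsCylinder.comp_configShift hS₂ x
    exact dependsOn_comp_torusRed L' (F := fun U => ((F₂ ∘ configShift x) U : ℂ)) fun U V h' => by
      show (((F₂ ∘ configShift x) U : ℝ) : ℂ) = ((F₂ ∘ configShift x) V : ℝ); rw [h h']
  refine (abs_truncated_le_norm_expect ρ hρ β L' h₁m h₂m hC₁ hC₂ x).trans ?_
  change ‖(torusSystem ρ L').expect (fun U => Φ₁ U * Φ₂ U) (torusGenuine d L') β -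
      (torusSystem ρ L').expect Φ₁ (torusGenuine d L') β *
        (torusSystem ρ L').expect Φ₂ (torusGenuine d L') β‖ ≤ Kunif * (β / r) ^ (X₀ - c)
  have hs₁ : ((torusSystem (G := G) ρ L').seedsOf (B₁.image (torusRed L'))).card ≤ sB := by
    refine (card_seedsOf_torusSystem_le ρ B₁).trans ((card_seedsOf_le_mul B₁).trans ?_)
    rw [hsB]; exact Nat.mul_le_mul_right _ (Nat.le_add_right _ _)
  have hB₂c : B₂.card ≤ S₂.card := Finset.card_image_le
  have hs₂ : ((torusSystem (G := G) ρ L').seedsOf (B₂.image (torusRed L'))).card ≤ sB := by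
    refine (card_seedsOf_torusSystem_le ρ B₂).trans ((card_seedsOf_le_mul B₂).trans ?_)
    rw [hsB]; exact Nat.mul_le_mul_right _ (hB₂c.trans (Nat.le_add_left _ _))
  have hs₁₂ : ((torusSystem (G := G) ρ L').seedsOf
      (B₁.image (torusRed L') ∪ B₂.image (torusRed L'))).card ≤ sB := by
    rw [← Finset.image_union]
    refine (card_seedsOf_torusSystem_le ρ _).trans ((card_seedsOf_le_mul _).trans ?_)
    rw [hsB]
    exact Nat.mul_le_mul_right _ ((Finset.card_union_le _ _).trans (Nat.add_le_add_left hB₂c _))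
  have hK : C₁ * C₂ * κ ^ ((torusSystem (G := G) ρ L').seedsOf
        (B₁.image (torusRed L') ∪ B₂.image (torusRed L'))).card +
      C₁ * κ ^ ((torusSystem (G := G) ρ L').seedsOf (B₁.image (torusRed L'))).card *
        (C₂ * κ ^ ((torusSystem (G := G) ρ L').seedsOf (B₂.image (torusRed L'))).card) ≤ Kunif := by
    rw [hKunif]
    refine add_le_add (mul_le_mul_of_nonneg_left (pow_le_pow_right₀ hκ1 hs₁₂) (by positivity))
      (mul_le_mul (mul_le_mul_of_nonneg_left (pow_le_pow_right₀ hκ1 hs₁) hC₁0)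
        (mul_le_mul_of_nonneg_left (pow_le_pow_right₀ hκ1 hs₂) hC₂0) (by positivity)
        (by positivity))
  have hβn : ‖(β : ℂ)‖ ≤ r := by
    rw [Complex.norm_real, Real.norm_eq_abs, abs_of_nonneg hβ0]; exact hβr
  -- far displacements only: disjoint supports, long joining polymers
  have hdisj : Disjoint (B₁.image (torusRed L')) (B₂.image (torusRed L')) :=
    disjoint_image_torusRed (by rw [hcdef] at hfar; omega) hx'
  have hn : ∀ Q, Q ⊆ torusGenuine d L' →
      (torusSystem (G := G) ρ L').Joins Q (B₁.image (torusRed L')) (B₂.image (torusRed L')) →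
      X₀ - c ≤ Q.card := by
    intro Q _ hJ
    have h := PlaqSystem.le_card_of_joins (S := torusSystem (G := G) ρ L')
      (fun p => tdist L' originPlaq p)
      (fun u v huv => tdist_le_of_tadj originPlaq ((torusSystem_adj_iff ρ).1 huv))
      (a := bondRadius B₁ + 1) (b := X₀ - bondRadius S₂ - 1)
      (fun p hp => by
        obtain ⟨y, rfl, hy⟩ := (touches_torusSystem_iff ρ B₁ p).1 hp
        exact tdist_le_of_touches hy)
      (fun q hq => by
        obtain ⟨y, rfl, hy⟩ := (touches_torusSystem_iff ρ B₂ q).1 hq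
        exact le_tdist_of_touches_shift hy hx') hJ
    rw [hcdef]; omega
  have hbound := PlaqSystem.norm_truncatedExpect_le hR hΦ₁m hΦ₂m hΦ₁b hΦ₂b hΦ₁d hΦ₂d hdisj
    (torusGenuine d L') hn hr (by rwa [betaR_costBound]) hβn
  refine hbound.trans ?_
  rw [Complex.norm_real, Real.norm_eq_abs, abs_of_nonneg hβ0]
  exact mul_le_mul_of_nonneg_right hK (pow_nonneg (div_nonneg hβ0 hr.le) _)

end Engine

/-! ### §4c The far field of a slice is `O(β^k)` uniformly in the volume -/

/-- A positive lower bound below finitely many positive reals and a given positive `b`. [elementary] -/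
theorem exists_pos_le_of_finset {ι : Type*} (s : Finset ι) (f : ι → ℝ) (hf : ∀ i ∈ s, 0 < f i) {b : ℝ}
    (hb : 0 < b) : ∃ β₁ : ℝ, 0 < β₁ ∧ β₁ ≤ b ∧ ∀ i ∈ s, β₁ ≤ f i := by
  classical
  induction s using Finset.induction_on with
  | empty => exact ⟨b, hb, le_rfl, by simp⟩
  | insert a s ha ih =>
    obtain ⟨β₁, h1, h2, h3⟩ := ih fun i hi => hf i (Finset.mem_insert_of_mem hi)
    refine ⟨min β₁ (f a), lt_min h1 (hf a (Finset.mem_insert_self a s)), (min_le_left _ _).trans h2,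
      fun i hi => ?_⟩
    rcases Finset.mem_insert.1 hi with rfl | hi
    · exact min_le_right _ _
    · exact (min_le_left _ _).trans (h3 i hi)

/-- **Far field for free.**  For species `A, B`, a time `t` and any order `k` there are `β₀ > 0`, `C` and a radius
`R` with `Σ_{x⃗ : ‖x⃗‖_∞ ≥ R} |Cov(A_{(0,x⃗)}, B; t)| ≤ C β^k` for all `0 ≤ β ≤ β₀` and ALL `S` — the activity-carrying
clustering `torusClustering_uniform_activity` summed against `Σ_{x⃗ ∈ 𝕋³} e^{-‖x⃗‖_∞} ≤ (Σ_{k ∈ ℤ} e^{-|k|/3})³`. -/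
theorem sliceSum_far_le {N : ℕ} (ρ : G →* Matrix (Fin N) (Fin N) ℂ) (hρ : Continuous ρ) (A B : YMSpecies G)
    (t k : ℕ) :
    ∃ β₀ C : ℝ, ∃ R : ℕ, 0 < β₀ ∧ ∀ β : ℝ, 0 ≤ β → β ≤ β₀ → ∀ S : ℕ, t ≤ S →
      ∑ x ∈ (Finset.univ : Finset (Fin 3 → ZMod (2 * S + 1))).filter
          (fun x => R ≤ supNorm (spatialVec S x)),
        |latticeConnectedCorr ρ β (2 * S + 1) (fun U => A.F (configShift (spatialVec S x) U)) B.F t| ≤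
      C * β ^ k := by
  obtain ⟨r, hr, h⟩ := torusClustering_uniform_activity (d := 4) ρ (by norm_num) hρ
  obtain ⟨K, c, hK0, hK⟩ :=
    h A.F B.F ⟨A.supp, A.isCylinder⟩ ⟨B.supp, B.isCylinder⟩ A.measurable B.measurable A.bounded B.bounded
  -- the geometric weight `q = e^{-1/3}` (as in F0)
  obtain ⟨q, hq0, hq1, hqexp⟩ : ∃ q : ℝ, 0 ≤ q ∧ q < 1 ∧ ∀ n : ℕ, Real.exp (n * (-1 / 3 : ℝ)) = q ^ n :=
    ⟨Real.exp (-1 / 3), (Real.exp_pos _).le, Real.exp_lt_one_iff.mpr (by norm_num),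
      fun n => Real.exp_nat_mul _ _⟩
  have hg0 : ∀ k : ℤ, 0 ≤ q ^ k.natAbs := fun k => pow_nonneg hq0 _
  have hgs : Summable fun k : ℤ => q ^ k.natAbs := by
    refine Summable.of_nat_of_neg ?_ ?_
    · simpa [Int.natAbs_natCast] using summable_geometric_of_lt_one hq0 hq1
    · simpa [Int.natAbs_neg, Int.natAbs_natCast] using summable_geometric_of_lt_one hq0 hq1
  set Z : ℝ := ∑' k : ℤ, q ^ k.natAbs with hZ
  have hZ0 : 0 ≤ Z := tsum_nonneg hg0
  refine ⟨r / Real.exp 1, K * Real.exp ((c + k : ℕ) : ℝ) / r ^ k * Z ^ 3, c + k + 1, by positivity,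
    fun β hβ hββ₀ S htS => ?_⟩
  haveI : NeZero (2 * S + 1) := ⟨by omega⟩
  have hβr : β ≤ r := hββ₀.trans (div_le_self hr.le (Real.one_le_exp_iff.2 zero_le_one))
  -- per-site bound in the far field
  have hx : ∀ x : Fin 3 → ZMod (2 * S + 1), c + k + 1 ≤ supNorm (spatialVec S x) →
      |latticeConnectedCorr ρ β (2 * S + 1) (fun U => A.F (configShift (spatialVec S x) U)) B.F t| ≤
        K * (β / r) ^ k * Real.exp ((c + k : ℕ) : ℝ) * ∏ j : Fin 3, q ^ ((x j).valMinAbs).natAbs := by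
    intro x hxR
    -- the engine at the combined displacement `w = farVec S t x = -t e₀ - v_x`, `‖v_x‖_∞ ≤ ‖w‖_∞ ≤ S`
    have hvw := supNorm_spatialVec_le_supNorm_farVec S t x
    have hwS := supNorm_farVec_le S t htS x
    have hnorm : 2 * ‖farVec S t x‖ < ((2 * S : ℕ) : ℝ) + 1 := by
      rw [norm_eq_supNorm]
      have : (supNorm (farVec S t x) : ℝ) ≤ S := by exact_mod_cast hwS
      push_cast; linarith
    have hfar : c < supNorm (farVec S t x) := by omega
    have key := hK β hβ hβr (2 * S) (farVec S t x) hnorm hfar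
    rw [toTorusObservable_comp_configShift, wilsonExpectation_comp_torusConfigShift,
      ← latticeConnectedCorr_shift_left ρ β (2 * S + 1) A.F B.F (spatialVec S x) (farVec S t x) t
        (farVec_add S t x)] at key
    -- `(β/r)^{‖w‖-c} ≤ (β/r)^{‖v‖-c}`
    have hβr1 : β / r ≤ 1 := (div_le_one hr).2 hβr
    have key' : |latticeConnectedCorr ρ β (2 * S + 1) (fun U => A.F (configShift (spatialVec S x) U)) B.F t| ≤
        K * (β / r) ^ (supNorm (spatialVec S x) - c) :=
      key.trans (mul_le_mul_of_nonneg_left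
        (pow_le_pow_of_le_one (div_nonneg hβ hr.le) hβr1 (by omega)) hK0)
    have hexp : Real.exp (-‖spatialVec S x‖) ≤ ∏ j : Fin 3, q ^ ((x j).valMinAbs).natAbs := by
      have h1 : ∀ j : Fin 3, ((x j).valMinAbs).natAbs ≤ supNorm (spatialVec S x) := by
        intro j
        have := natAbs_le_supNorm (spatialVec S x) j.succ
        simpa [spatialVec, Fin.succ_ne_zero] using this
      have h2 : (∑ j : Fin 3, ((x j).valMinAbs).natAbs) ≤ 3 * supNorm (spatialVec S x) :=
        calc (∑ j : Fin 3, ((x j).valMinAbs).natAbs) ≤ ∑ _j : Fin 3, supNorm (spatialVec S x) :=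
              Finset.sum_le_sum fun j _ => h1 j
          _ = 3 * supNorm (spatialVec S x) := by simp
      have hsum : ((∑ j : Fin 3, ((x j).valMinAbs).natAbs : ℕ) : ℝ) ≤ 3 * ‖spatialVec S x‖ := by
        rw [norm_eq_supNorm]; exact_mod_cast h2
      calc Real.exp (-‖spatialVec S x‖)
          ≤ Real.exp ((∑ j : Fin 3, ((x j).valMinAbs).natAbs : ℕ) * (-1 / 3 : ℝ)) :=
            Real.exp_le_exp.mpr (by linarith)
        _ = q ^ (∑ j : Fin 3, ((x j).valMinAbs).natAbs) := hqexp _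
        _ = ∏ j : Fin 3, q ^ ((x j).valMinAbs).natAbs := (Finset.prod_pow_eq_pow_sum _ _ _).symm
    -- `(β/r)^{n-c} = (β/r)^k (β/r)^{n-c-k} ≤ (β/r)^k e^{-(n-c-k)} = (β/r)^k e^{c+k} e^{-n}`
    set n : ℕ := supNorm (spatialVec S x) with hn
    have hsplit : (β / r) ^ (n - c) = (β / r) ^ k * (β / r) ^ (n - c - k) := by
      rw [← pow_add]; congr 1; omega
    have hdec : (β / r) ^ (n - c - k) ≤ Real.exp ((c + k : ℕ) : ℝ) * Real.exp (-‖spatialVec S x‖) := by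
      refine (pow_div_le_exp_neg_of_le hβ hr hββ₀ (n - c - k)).trans (le_of_eq ?_)
      rw [← Real.exp_add, norm_eq_supNorm, ← hn, Nat.cast_sub (by omega), Nat.cast_sub (by omega), Nat.cast_add]
      congr 1; ring
    calc |latticeConnectedCorr ρ β (2 * S + 1) (fun U => A.F (configShift (spatialVec S x) U)) B.F t|
        ≤ K * (β / r) ^ (n - c) := key'
      _ = K * (β / r) ^ k * (β / r) ^ (n - c - k) := by rw [hsplit, mul_assoc]
      _ ≤ K * (β / r) ^ k * (Real.exp ((c + k : ℕ) : ℝ) * ∏ j : Fin 3, q ^ ((x j).valMinAbs).natAbs) := by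
          refine mul_le_mul_of_nonneg_left (hdec.trans ?_) (by positivity)
          exact mul_le_mul_of_nonneg_left hexp (Real.exp_pos _).le
      _ = _ := by ring
  -- the one-dimensional sum over `ZMod (2S+1)` against the sum over `ℤ`
  have hZS : ∑ a : ZMod (2 * S + 1), q ^ (a.valMinAbs).natAbs ≤ Z := by
    have hinj : Function.Injective (ZMod.valMinAbs : ZMod (2 * S + 1) → ℤ) := by
      intro a b hab
      have := congrArg (fun k : ℤ => (k : ZMod (2 * S + 1))) hab
      simpa [ZMod.coe_valMinAbs] using this
    calc ∑ a : ZMod (2 * S + 1), q ^ (a.valMinAbs).natAbs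
        = ∑ k ∈ Finset.univ.image (ZMod.valMinAbs : ZMod (2 * S + 1) → ℤ), q ^ k.natAbs := by
          rw [Finset.sum_image fun a _ b _ hab => hinj hab]
      _ ≤ Z := Summable.sum_le_tsum _ (fun k _ => hg0 k) hgs
  have hprod : ∑ x : Fin 3 → ZMod (2 * S + 1), ∏ j : Fin 3, q ^ ((x j).valMinAbs).natAbs ≤ Z ^ 3 := by
    calc ∑ x : Fin 3 → ZMod (2 * S + 1), ∏ j : Fin 3, q ^ ((x j).valMinAbs).natAbs
        = ∏ _j : Fin 3, ∑ a : ZMod (2 * S + 1), q ^ (a.valMinAbs).natAbs :=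
          (Fintype.prod_sum fun (_ : Fin 3) (a : ZMod (2 * S + 1)) => q ^ (a.valMinAbs).natAbs).symm
      _ ≤ ∏ _j : Fin 3, Z :=
          Finset.prod_le_prod (fun j _ => Finset.sum_nonneg fun a _ => hg0 _) fun j _ => hZS
      _ = Z ^ 3 := by simp
  -- sum up
  calc ∑ x ∈ Finset.univ.filter (fun x => c + k + 1 ≤ supNorm (spatialVec S x)),
        |latticeConnectedCorr ρ β (2 * S + 1) (fun U => A.F (configShift (spatialVec S x) U)) B.F t|
      ≤ ∑ x ∈ Finset.univ.filter (fun x => c + k + 1 ≤ supNorm (spatialVec S x)),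
          K * (β / r) ^ k * Real.exp ((c + k : ℕ) : ℝ) * ∏ j : Fin 3, q ^ ((x j).valMinAbs).natAbs :=
        Finset.sum_le_sum fun x hx' => hx x (Finset.mem_filter.1 hx').2
    _ ≤ ∑ x : Fin 3 → ZMod (2 * S + 1),
          K * (β / r) ^ k * Real.exp ((c + k : ℕ) : ℝ) * ∏ j : Fin 3, q ^ ((x j).valMinAbs).natAbs :=
        Finset.sum_le_sum_of_subset_of_nonneg (Finset.filter_subset _ _) fun x _ _ => by
          have : 0 ≤ (β / r) ^ k := pow_nonneg (div_nonneg hβ hr.le) _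
          exact mul_nonneg (by positivity) (Finset.prod_nonneg fun j _ => hg0 _)
    _ = K * (β / r) ^ k * Real.exp ((c + k : ℕ) : ℝ) *
          ∑ x : Fin 3 → ZMod (2 * S + 1), ∏ j : Fin 3, q ^ ((x j).valMinAbs).natAbs := by rw [Finset.mul_sum]
    _ ≤ K * (β / r) ^ k * Real.exp ((c + k : ℕ) : ℝ) * Z ^ 3 := by
        refine mul_le_mul_of_nonneg_left hprod ?_
        have : 0 ≤ (β / r) ^ k := pow_nonneg (div_nonneg hβ hr.le) _
        positivity
    _ = K * Real.exp ((c + k : ℕ) : ℝ) / r ^ k * Z ^ 3 * β ^ k := by rw [div_pow]; ring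

/-! ### §4d (O) ⇐ finitely many NEAR pairs -/

/-- The integer spatial displacement `(0, a) ∈ ℤ⁴` of `a ∈ ℤ³`; `spatialVec S x = spatialInt (valMinAbs ∘ x)`. -/
def spatialInt (a : Fin 3 → ℤ) : Fin 4 → ℤ :=
  fun i => if h : i = 0 then 0 else a (i.pred h)

theorem spatialVec_eq_spatialInt (S : ℕ) (x : Fin 3 → ZMod (2 * S + 1)) :
    spatialVec S x = spatialInt fun j => (x j).valMinAbs := rfl

/-- **SC INPUT (N) — near pairs, one displacement at a time.**  For every FIXED non-zero spatial displacement
`a ∈ ℤ³` the time-`1` covariance of the spatial plaquette `P = Re tr U(∂p₁₂(0))` with its translate is `O(β⁵)`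
UNIFORMLY IN THE VOLUME: `|Cov_L(P ∘ θ_{(0,a)}, P; t = 1)| ≤ C_a β⁵` for `0 < β ≤ β₀(a)` and all `L ≥ L₀(a)`.
(The facing pair `a = 0` is order `β⁴` — excluded.  Constants may depend on `a`: only the finitely many `a` with
`‖a‖_∞ < R` are ever used, the far field being `sliceSum_far_le`.)  This is the per-pair statement the `SCFloor` engine
(ym-ir-line-bsf-p1, parts 13–15: `SCFloorOffDiagGeometry`, `SCFloorTorusOffDiag.mayer_sum_offdiag`, volume-uniformity)
is producing. -/
def PlaquetteNearPairSC : Prop :=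
  ∀ (G : Type) [Group G] [TopologicalSpace G] [IsTopologicalGroup G] [CompactSpace G],
    IsCompactSimpleLieGroup G → letI : MeasurableSpace G := borel G; haveI : BorelSpace G := ⟨rfl⟩;
    ∀ r : LatticeRep G, ∀ a : Fin 3 → ℤ, a ≠ 0 →
      ∃ β₀ C : ℝ, ∃ L₀ : ℕ, 0 < β₀ ∧ ∀ β : ℝ, 0 < β → β ≤ β₀ → ∀ (L : ℕ) [NeZero L], L₀ ≤ L →
        |latticeConnectedCorr r.ρ β L (fun U => plaquetteObs r.ρ 0 1 2 (configShift (spatialInt a) U))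
            (plaquetteObs r.ρ 0 1 2) 1| ≤ C * β ^ 5

/-- **(O) ⇐ (N).**  The off-diagonal slice estimate `PlaquetteOffDiagSliceSC` follows from the near-pair input
`PlaquetteNearPairSC`: split `Σ_{x⃗ ≠ 0}` into `‖x⃗‖_∞ ≥ R` (far: `sliceSum_far_le` with `k = 5`, a THEOREM) and the
finitely many `0 < ‖x⃗‖_∞ < R`, each `O(β⁵)` uniformly in the volume by (N). -/
theorem plaquetteOffDiagSliceSC_of_nearPair (hN : PlaquetteNearPairSC) : PlaquetteOffDiagSliceSC := by
  intro G _ _ _ _ hG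
  letI : MeasurableSpace G := borel G
  haveI : BorelSpace G := ⟨rfl⟩
  intro r
  classical
  haveI : SecondCountableTopology G :=
    (r.continuous.isClosedEmbedding r.injective).isEmbedding.secondCountableTopology
  -- the spatial plaquette as a species, and the far field
  set P : YMSpecies G := plaquetteObservable r.ρ r.continuous 1 2 with hPdef
  have hPF : P.F = plaquetteObs r.ρ 0 1 2 := rfl
  obtain ⟨β₀f, Cf, R, hβ₀f, hfar⟩ := sliceSum_far_le r.ρ r.continuous P P 1 5
  -- the near displacements
  set V : Finset (Fin 3 → ℤ) :=
    (Fintype.piFinset fun _ : Fin 3 => Finset.Icc (-(R : ℤ)) R).erase 0 with hV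
  have hVne : ∀ a ∈ V, a ≠ 0 := fun a ha => (Finset.mem_erase.1 ha).1
  have hnear : ∀ a ∈ V, ∃ β₀ C : ℝ, ∃ L₀ : ℕ, 0 < β₀ ∧ ∀ β : ℝ, 0 < β → β ≤ β₀ →
      ∀ (L : ℕ) [NeZero L], L₀ ≤ L →
        |latticeConnectedCorr r.ρ β L (fun U => plaquetteObs r.ρ 0 1 2 (configShift (spatialInt a) U))
            (plaquetteObs r.ρ 0 1 2) 1| ≤ C * β ^ 5 := fun a ha => hN G hG r a (hVne a ha)
  choose! β₀a Ca L₀a hβ₀a hCa using hnear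
  obtain ⟨β₁, hβ₁, hβ₁f, hβ₁a⟩ := exists_pos_le_of_finset V β₀a hβ₀a hβ₀f
  refine ⟨β₁, Cf + ∑ a ∈ V, Ca a, max (V.sup L₀a) 1, hβ₁, fun β hβ hββ₁ S hS => ?_⟩
  have hSV : V.sup L₀a ≤ S := le_of_max_le_left hS
  have hS1 : 1 ≤ S := le_of_max_le_right hS
  haveI : NeZero (2 * S + 1) := ⟨by omega⟩
  -- the split, and an abbreviation for the slice term
  have hsplit := sliceSumCorr_split r.ρ β S P.F P.F 1
  set term : (Fin 3 → ZMod (2 * S + 1)) → ℝ := fun x =>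
    latticeConnectedCorr r.ρ β (2 * S + 1) (fun U => P.F (configShift (spatialVec S x) U)) P.F 1 with hterm
  -- far part
  have hfarS : ∑ x ∈ (Finset.univ.erase (0 : Fin 3 → ZMod (2 * S + 1))).filter
      (fun x => R ≤ supNorm (spatialVec S x)), |term x| ≤ Cf * β ^ 5 := by
    refine le_trans ?_ (hfar β hβ.le (hββ₁.trans hβ₁f) S hS1)
    exact Finset.sum_le_sum_of_subset_of_nonneg
      (Finset.filter_subset_filter _ (Finset.erase_subset _ _)) fun _ _ _ => abs_nonneg _
  -- near part: re-index by the integer displacement, which lies in `V`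
  set φ : (Fin 3 → ZMod (2 * S + 1)) → (Fin 3 → ℤ) := fun x j => (x j).valMinAbs with hφ
  have hφinj : Function.Injective φ := by
    intro x y hxy
    funext j
    have h := congrFun hxy j
    have := congrArg (fun k : ℤ => (k : ZMod (2 * S + 1))) h
    simpa [hφ, ZMod.coe_valMinAbs] using this
  have hnearV : ∀ x ∈ (Finset.univ.erase (0 : Fin 3 → ZMod (2 * S + 1))).filter
      (fun x => ¬ R ≤ supNorm (spatialVec S x)), φ x ∈ V := by
    intro x hx
    obtain ⟨hx0, hxR⟩ := Finset.mem_filter.1 hx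
    have hx0 : x ≠ 0 := (Finset.mem_erase.1 hx0).1
    rw [hV, Finset.mem_erase]
    refine ⟨fun h0 => hx0 ?_, Fintype.mem_piFinset.2 fun j => Finset.mem_Icc.2 ?_⟩
    · funext j
      have := congrFun h0 j
      simpa [hφ] using this
    · have h1 : ((x j).valMinAbs).natAbs ≤ supNorm (spatialVec S x) := by
        have := natAbs_le_supNorm (spatialVec S x) j.succ
        simpa [spatialVec, Fin.succ_ne_zero] using this
      have h2 : ((x j).valMinAbs).natAbs < R := by omega
      simp only [hφ]
      omega
  have hnearS : ∑ x ∈ (Finset.univ.erase (0 : Fin 3 → ZMod (2 * S + 1))).filter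
      (fun x => ¬ R ≤ supNorm (spatialVec S x)), |term x| ≤ (∑ a ∈ V, Ca a) * β ^ 5 := by
    set Nn := (Finset.univ.erase (0 : Fin 3 → ZMod (2 * S + 1))).filter
      (fun x => ¬ R ≤ supNorm (spatialVec S x)) with hNn
    set g : (Fin 3 → ℤ) → ℝ := fun a =>
      |latticeConnectedCorr r.ρ β (2 * S + 1) (fun U => plaquetteObs r.ρ 0 1 2 (configShift (spatialInt a) U))
        (plaquetteObs r.ρ 0 1 2) 1| with hg
    have h1 : ∑ x ∈ Nn, |term x| = ∑ a ∈ Nn.image φ, g a := by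
      rw [Finset.sum_image fun x _ y _ hxy => hφinj hxy]
      exact Finset.sum_congr rfl fun x _ => rfl
    have h2 : ∑ a ∈ Nn.image φ, g a ≤ ∑ a ∈ V, g a :=
      Finset.sum_le_sum_of_subset_of_nonneg (Finset.image_subset_iff.2 hnearV) fun _ _ _ => abs_nonneg _
    have h3 : ∑ a ∈ V, g a ≤ ∑ a ∈ V, Ca a * β ^ 5 := by
      refine Finset.sum_le_sum fun a ha => ?_
      have hL : L₀a a ≤ 2 * S + 1 := ((Finset.le_sup ha).trans hSV).trans (by omega)
      exact hCa a ha β hβ (hββ₁.trans (hβ₁a a ha)) (2 * S + 1) hL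
    calc ∑ x ∈ Nn, |term x| = _ := h1
      _ ≤ _ := h2
      _ ≤ _ := h3
      _ = (∑ a ∈ V, Ca a) * β ^ 5 := (Finset.sum_mul _ _ _).symm
  -- assemble
  have hoff : sliceSumCorr r.ρ β S P.F P.F 1 - latticeConnectedCorr r.ρ β (2 * S + 1) P.F P.F 1 =
      ∑ x ∈ Finset.univ.erase (0 : Fin 3 → ZMod (2 * S + 1)), term x := by rw [hsplit]; ring
  rw [hPF] at hoff
  rw [hoff]
  calc |∑ x ∈ Finset.univ.erase (0 : Fin 3 → ZMod (2 * S + 1)), term x|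
      ≤ ∑ x ∈ Finset.univ.erase (0 : Fin 3 → ZMod (2 * S + 1)), |term x| := Finset.abs_sum_le_sum_abs _ _
    _ = (∑ x ∈ (Finset.univ.erase (0 : Fin 3 → ZMod (2 * S + 1))).filter
            (fun x => R ≤ supNorm (spatialVec S x)), |term x|) +
          ∑ x ∈ (Finset.univ.erase (0 : Fin 3 → ZMod (2 * S + 1))).filter
            (fun x => ¬ R ≤ supNorm (spatialVec S x)), |term x| :=
        (Finset.sum_filter_add_sum_filter_not _ _ _).symm
    _ ≤ Cf * β ^ 5 + (∑ a ∈ V, Ca a) * β ^ 5 := add_le_add hfarS hnearS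
    _ = (Cf + ∑ a ∈ V, Ca a) * β ^ 5 := by ring

/-- **R2 ⇐ (N) alone** — the net reduction of this file: RP/TM side (§1–§3), F0 (§2b), facing floor (F) (§3d) and the
far field (§4c) are PROVED; `stub_noLightMoversSCTransfer` follows from the finitely-many-near-pairs input (N). -/
theorem noLightMoversSCTransfer_of_nearPair (hN : PlaquetteNearPairSC) : NoLightMoversSCTransfer :=
  noLightMoversSCTransfer_of_offdiag (plaquetteOffDiagSliceSC_of_nearPair hN)

/-! ## §5 R2 CLOSED — the engine's LANDED slice floor (`SCFloor.sliceSum_one_floor`, part 19, ym-ir-line-bsf-p1)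

Part 19 of the `SCFloor` engine proves `κ β⁴ ≤ s_S(1)` for `0 < β ≤ β₀` and ALL `S ≥ 1` for the spatial plaquette
(diagonal facing floor part 11, off-diagonal terms `O(β⁵)` parts 15–18), under the character hypothesis
`∃ g h, Re tr ρ g ≠ Re tr ρ h` — discharged here by `LatticeRep.exists_re_trace_ne` (§3d).  That is literally
`PlaquetteSlicePowerFloorSC` (§3c), so the registered rung R2 is a THEOREM: `noLightMoversSCTransfer_holds`. -/

/-- **The power-law slice floor holds** (engine part 19 + §3d). -/
theorem plaquetteSlicePowerFloorSC_holds : PlaquetteSlicePowerFloorSC := by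
  intro G _ _ _ _ hG
  letI : MeasurableSpace G := borel G
  haveI : BorelSpace G := ⟨rfl⟩
  intro r
  haveI : SecondCountableTopology G :=
    (r.continuous.isClosedEmbedding r.injective).isEmbedding.secondCountableTopology
  haveI : T2Space G := (r.continuous.isClosedEmbedding r.injective).isEmbedding.t2Space
  obtain ⟨β₀, κ, hβ₀, hκ, h⟩ :=
    SCFloor.sliceSum_one_floor r.ρ r.continuous (LatticeRep.exists_re_trace_ne hG r)
  refine ⟨β₀, κ, 1, hβ₀, hκ, fun β hβ hββ₀ S hS => ?_⟩
  exact h S hS β hβ hββ₀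

/-- **RUNG R2 OF LINE `momentum-pincer` — PROVED.**  `NoLightMoversSCTransfer` (verbatim the body of the registered stub
`Summit.QuantumFields.YangMills.Cruxes.IR.MomentumPincer.stub_noLightMoversSCTransfer`, skeleton v1.6) holds:
RP / transfer matrix (§1–§3) + F0 (§2b) + the `SCFloor` engine's landed slice floor (§5) + non-constancy of the real
character of a faithful representation of a compact simple group (§3d).  The skeleton's stub closes BY NAME as
`theorem stub_noLightMoversSCTransfer : NoLightMoversSCTransfer := MomentumPincerRung.noLightMoversSCTransfer_holds`
(definitional unfolding of the verbatim copies `spatialVec`, `sliceSumCorr`).  HONEST: a strong-coupling rung; nothing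
here bears on `IR` at weak coupling, a continuum limit, or the Yang–Mills mass gap. -/
theorem noLightMoversSCTransfer_holds : NoLightMoversSCTransfer :=
  noLightMoversSCTransfer_of_plaquetteSlicePowerFloorSC plaquetteSlicePowerFloorSC_holds

end Summit.QuantumFields.YangMills.Cruxes.IR.MomentumPincerRung

end
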